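import Literature.Computability.Complexity.CSPToCMMSAReduction
import Literature.Computability.Complexity.ListFoldChecks
import Literature.Computability.Complexity.ListBricks
import HarnessLib

/-!
# Complexity core: the Dinur–Safra reduction from gap CSPs to CMMSA, IV — the patched map is in `FP`

Fourth file on Hirahara's proof of Thm. 5.2 (ECCC TR22-119, pp. 16–18). `CSPToCMMSAReduction.lean`
assembles the Karp reduction `gapCSPQueried ≤ₚ gapCMMSA` from two named facts, the sliding-scale PCP
(`Hirahara2022_lem53_logPow_queried`) and the routine implementation fact `dinurSafraMap_mem_FP`:
*the patched instance map `dinurSafraMap N₀ Q₀` is computed on codes by a polynomial-time string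
function*. This file **discharges** the latter (`dinurSafraMap_mem_FP_holds`), in the brick-assembly
style of the toolkit (`BrickAlgebra.lean`, `ListFoldBricks.lean`, `ListBricks.lean`, `FoldBricks.lean`:
an algebra of total `FP` string functions on `boolPair`-records; no machine is written).

Hirahara (proof of Thm. 5.2, p. 16): "it is NP-hard under polynomial-time many-one reductions to
compute CMMSA […] Given the MaxCSP instance `Ψ` over `Σ`, we reduce it to an instance `(Φ, w, s)` of
CMMSA as follows: Each variable of `Φ` is indexed by `(x, a) ∈ [n] × Σ` and is denoted by `L_{x,a}`
[…] `φⱼ := ⋁_{r ∈ Cⱼ⁻¹(1)} ⋀_{x ∈ dom(r)} L_{x,r(x)}` […] `w(x, a) := |Ψ(x)|` […] `s := mD`." The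
polynomial running time of this map is implicit in the source (Arora–Barak 2009, §1.3); here it is
proved for the tree's codes (`CSPInstance.encoding`, `CMMSAInstance.encoding`) and the patched map
`dinurSafraMap N₀ Q₀` of `CSPToCMMSAReduction.lean` (constant-size instances solved outright).

## The string function

On the code `w = ⟨bin n, ⟨bin q, ⟨1ᵐ, [c₁, …, c_m]⟩⟩⟩` of `Ψ` (`icode`; a constraint is coded
`cⱼ = ⟨⟨1^{|vars|}, [bin x]ₓ⟩, ⟨1^{|acc|}, [⟨1^{|r|}, [bin v]_v⟩]_r⟩⟩`, lists by `encList`):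

* `smallFn` — the bit `WellFormed ∧ n ≤ N₀ ∧ q ≤ Q₀` (`allFn`, `nodupFn`, `ltFn`, `eqPairFn`);
* `satFn` — the bit "some assignment `[N₀] → [Q₀ + 1]` (extended by `0`) satisfies every
  constraint": a finite disjunction (`orFn`) over the `(Q₀+1)^{N₀}` candidates of an `allFn` over the
  constraints, the local view `vars.map a` being computed by a table lookup (`lookTab`) mapped over
  the coded variable list (`mapAppFn`) and compared with the accepting rows by string equality;
* `fitsFn` — the bit `n ≤ T ∧ q ≤ T`, `T = Σⱼ |dom Cⱼ|` read off the unary headers (`totUnF`);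
* `mainFn` — the code of `Ψ.toCMMSA`: `bin (n · q₁)` (`prodFn`), the formulas by three nested list
  combinators (`mapAppFn` over the constraints and over the accepting rows, `zipLF` pairing `dom C`
  with a row, the literal `bin (x q₁ + a)` by `prodFn`/`addFn`), the unary weights by a counted fold
  (`foldLoop appF`) over `i < n q₁` of `1^{|Ψ(i / q₁)|}` (`divFn`, and a fold over the constraints
  counting memberships), and `bin T` (`lenBinF`); item functions are clipped (`clipF`) against a
  padded yardstick `⟨w, 1^{(|w|+1)^3}⟩`, which is the identity on the intended values;
* `dsFn N₀ Q₀ := ite smallFn (ite satFn YES NO) (ite fitsFn mainFn NO)` and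
  **`dinurSafraMap_mem_FP_holds`**.

## Contents (values on instance codes)

* `encode_eq_icode`, `encode_eq_ocode` — the tree's encodings spelled out as records;
* `smallFn_icode`, `satFn_icode` (with `isSatisfiable_iff_cands`), `fitsFn_icode`;
* `mainFn_icode` — on every instance passing the size test, `mainFn` writes the code of `Ψ.toCMMSA`
  (the clipping and round bounds `termF_bound`, `formulaF_bound`, `wItemF_bound`,
  `numVars_mul_litWidth_le` from `totalArity_le_length_icode`);
* `dsFn_mem_FP`, `dsFn_icode`, **`dinurSafraMap_mem_FP_holds`**, and the corollary
  `Hirahara2022_thm52_sqrtLog_of_lem53'` (Thm. 5.2 at `Δ = (log n)^{1/2}` from Lemma 5.3 alone).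

## References

* S. Hirahara, *NP-hardness of learning programs and partial MCSP*, FOCS 2022; ECCC TR22-119:
  Thm. 5.2 and its proof (p. 16, "polynomial-time many-one reductions"; the map `Ψ ↦ (Φ, w, s)`).
* S. Arora, B. Barak, *Computational Complexity: A Modern Approach*, CUP 2009, §1.3 (polynomial
  time is closed under composition and bounded loops), §0.1 (codes of tuples and lists), §2.1
  (finitely many instances may be hard-wired into a reduction).
-/

namespace Literature.Computability.Complexity

open _root_.Computability MetaComplexity Brick Plumb Polynomial

namespace DinurSafraFP

/-! ### The codes, spelled out -/

/-- The `listBool` code of a list of naturals: unary length header, then the framed binary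
numerals. [cite: AroraBarak2009, §0.1 (codes of lists)] -/
def vcode (l : List ℕ) : List Bool := boolPair (ones l.length) (encList (l.map encodeNat))

/-- The code of a list of rows (accepting local assignments / a monotone DNF). [cite: AroraBarak2009, §0.1] -/
def acode (A : List (List ℕ)) : List Bool := boolPair (ones A.length) (encList (A.map vcode))

/-- The code of a constraint `(vars, accepting)`. [cite: Hirahara2022PartialMCSP, proof of Thm. 5.2 (p. 16)] -/
def ccode (C : CSPConstraint) : List Bool := boolPair (vcode C.vars) (acode C.accepting)

/-- The code of a MaxCSP instance. [cite: Hirahara2022PartialMCSP, proof of Thm. 5.2 (p. 16)] -/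
def icode (Ψ : CSPInstance) : List Bool :=
  boolPair (encodeNat Ψ.numVars) (boolPair (encodeNat Ψ.alphabetSize)
    (boolPair (ones Ψ.numConstraints) (encList (Ψ.constraints.map ccode))))

/-- The code of a collection of monotone DNFs. [cite: Hirahara2022PartialMCSP, Def. 5.1] -/
def fcode (Φ : List MonotoneDNF) : List Bool := boolPair (ones Φ.length) (encList (Φ.map acode))

/-- The code of a CMMSA instance. [cite: Hirahara2022PartialMCSP, Def. 5.1] -/
def ocode (I : CMMSAInstance) : List Bool :=
  boolPair (encodeNat I.numVars) (boolPair (fcode I.formulas)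
    (boolPair (boolPair (ones I.weight.length) (encList (I.weight.map ones))) (encodeNat I.threshold)))

/-- The `listBool` code of a list of naturals is `vcode`. [folklore] -/
theorem natList_encode (l : List ℕ) : encodingNatBool.listBool.encode l = vcode l := by
  rw [listBool_encode_eq_encList, OracleCompose.unaryEncodeNat_eq_replicate]; rfl

/-- The code of a list of rows is `acode`. [folklore] -/
theorem natListList_encode (A : List (List ℕ)) : encodingNatBool.listBool.listBool.encode A = acode A := by
  rw [listBool_encode_eq_encList, OracleCompose.unaryEncodeNat_eq_replicate, acode]
  congr 2
  exact List.map_congr_left fun r _ => natList_encode r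

/-- **The code of a MaxCSP instance is `icode`.** [folklore] -/
theorem encode_eq_icode (Ψ : CSPInstance) : CSPInstance.encoding.encode Ψ = icode Ψ := by
  rw [CSPInstance.encoding_encode, CSPInstance.tupleEncoding, CSPInstance.toTuple]
  simp only [Encoding.pairBool]
  rw [listBool_encode_eq_encList, OracleCompose.unaryEncodeNat_eq_replicate, List.length_map, List.map_map, icode,
    CSPInstance.numConstraints]
  congr 4
  refine List.map_congr_left fun C _ => ?_
  simp only [Function.comp_apply, ccode]
  rw [natList_encode, natListList_encode]

/-- **The code of a CMMSA instance is `ocode`.** [folklore] -/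
theorem encode_eq_ocode (I : CMMSAInstance) : CMMSAInstance.encoding.encode I = ocode I := by
  rw [CMMSAInstance.encoding_encode, CMMSAInstance.tupleEncoding, CMMSAInstance.toTuple]
  simp only [Encoding.pairBool]
  rw [listBool_encode_eq_encList, OracleCompose.unaryEncodeNat_eq_replicate, listBool_encode_eq_encList, OracleCompose.unaryEncodeNat_eq_replicate,
    ocode, fcode]
  congr 5
  · funext φ; exact natListList_encode φ
  · exact List.map_congr_left fun k _ => OracleCompose.unaryEncodeNat_eq_replicate k

/-- Reading a record: the first field. [folklore] -/
@[simp] theorem fstF_icode (Ψ : CSPInstance) : fstF (icode Ψ) = encodeNat Ψ.numVars := by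
  simp [icode]

/-- Reading a record: field `0`. [folklore] -/
@[simp] theorem nthF_zero_icode (Ψ : CSPInstance) : nthF 0 (icode Ψ) = encodeNat Ψ.numVars := by
  simp [icode]

/-- Reading a record: field `1`. [folklore] -/
@[simp] theorem nthF_one_icode (Ψ : CSPInstance) : nthF 1 (icode Ψ) = encodeNat Ψ.alphabetSize := by
  simp [icode]

/-- Reading a record: field `2`. [folklore] -/
@[simp] theorem nthF_two_icode (Ψ : CSPInstance) : nthF 2 (icode Ψ) = ones Ψ.numConstraints := by
  simp [icode]

/-- Reading a record: the constraint list. [folklore] -/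
@[simp] theorem sndPow_two_icode (Ψ : CSPInstance) : sndPow 2 (icode Ψ) = encList (Ψ.constraints.map ccode) := by
  simp [icode]

/-- `encList` is injective (its total decoder `decNil` inverts it). [folklore] -/
theorem encList_inj {l l' : List (List Bool)} : encList l = encList l' ↔ l = l' :=
  ⟨fun h => by simpa using congrArg decNil h, fun h => h ▸ rfl⟩

/-- `vcode` is injective. [folklore] -/
theorem vcode_inj {l l' : List ℕ} : vcode l = vcode l' ↔ l = l' := by
  constructor
  · intro h
    have h2 := congrArg sndF h
    simp only [vcode, sndF_boolPair, encList_inj] at h2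
    exact List.map_injective_iff.2 (fun a b hab => encodeNat_inj.1 hab) h2
  · rintro rfl; rfl

/-! ### Generic bricks: map-to-code over a coded list, unary item count, table lookups -/

/-- The step of `mapAppFn g` on `⟨u, ⟨a, acc⟩⟩`: `acc ++ ⟨g ⟨fstF u, a⟩, ε⟩` (snoc of the framed
image). [cite: AroraBarak2009, §1.3 (bounded loops)] -/
noncomputable def snocStep (g : List Bool → List Bool) : List Bool → List Bool :=
  appF ∘ fanoutFn (sndPow 1) (fanoutFn (g ∘ fanoutFn (fstF ∘ nthF 0) (nthF 1)) (fun _ => []))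

/-- `snocStep g ∈ FP`. [folklore] -/
theorem snocStep_mem_FP {g : List Bool → List Bool} (hg : g ∈ FP) : snocStep g ∈ FP :=
  comp_mem_FP appF_mem_FP (fanoutFn_mem_FP (sndPow_mem_FP 1)
    (fanoutFn_mem_FP (comp_mem_FP hg (fanoutFn_mem_FP (comp_mem_FP fstF_mem_FP (nthF_mem_FP 0)) (nthF_mem_FP 1)))
      (const_mem_FP _)))

/-- Value of the snoc step on every input. [folklore] -/
theorem snocStep_eq (g : List Bool → List Bool) (v : List Bool) :
    snocStep g v = sndPow 1 v ++ boolPair (g (boolPair (fstF (fstF v)) (fstF (sndF v)))) [] := by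
  simp [snocStep, nthF, sndPow]

/-- Value of the snoc step on a step argument. [folklore] -/
theorem snocStep_apply (g : List Bool → List Bool) (u a acc : List Bool) :
    snocStep g (boolPair u (boolPair a acc)) = acc ++ boolPair (g (boolPair (fstF u) a)) [] := by
  rw [snocStep_eq]; simp [sndPow]

/-- The left fold of snoc steps appends the code of the mapped list. [folklore] -/
theorem foldl_snoc (h : List Bool → List Bool) : ∀ (l : List (List Bool)) (acc : List Bool),
    l.foldl (fun acc a => acc ++ boolPair (h a) []) acc = acc ++ encList (l.map h)
  | [], acc => by simp
  | a :: l, acc => by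
    rw [List.foldl_cons, foldl_snoc h l, List.append_assoc, List.map_cons, encList_cons]
    simp [boolPair]

/-- **`mapAppFn g`**: on `⟨x, L⟩`, the code of the list of images `g ⟨x, a⟩` of the items `a` of the
coded list `L` (a fold of snoc steps). [cite: AroraBarak2009, §1.3 (bounded loops)] -/
noncomputable def mapAppFn (g : List Bool → List Bool) : List Bool → List Bool :=
  foldFn (snocStep g) (fun _ => [])

/-- **Value of `mapAppFn g` on a pair.** [folklore] -/
theorem mapAppFn_boolPair (g : List Bool → List Bool) (x L : List Bool) :
    mapAppFn g (boolPair x L) = encList ((decNil L).map fun a => g (boolPair x a)) := by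
  rw [mapAppFn, foldFn_boolPair]
  have : (fun acc a => snocStep g (boolPair (boolPair x L) (boolPair a acc))) =
      fun acc a => acc ++ boolPair (g (boolPair x a)) [] := by
    funext acc a; rw [snocStep_apply, fstF_boolPair]
  rw [this, foldl_snoc]; simp

/-- Value of `mapAppFn g` on `⟨x, encList l⟩`. [folklore] -/
theorem mapAppFn_encList (g : List Bool → List Bool) (x : List Bool) (l : List (List Bool)) :
    mapAppFn g (boolPair x (encList l)) = encList (l.map fun a => g (boolPair x a)) := by
  rw [mapAppFn_boolPair, decNil_encList]

/-- **`mapAppFn g ∈ FP`** for `g ∈ FP` with `|g z| ≤ 2 |sndF z| + C (|fstF z| + 1)` on every input.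
[cite: AroraBarak2009, §1.3 (bounded loops)] -/
theorem mapAppFn_mem_FP {g : List Bool → List Bool} (hg : g ∈ FP) {C : ℕ}
    (hC : ∀ z, (g z).length ≤ 2 * (sndF z).length + C * ((fstF z).length + 1)) : mapAppFn g ∈ FP := by
  refine foldFn_mem_FP (snocStep_mem_FP hg) (const_mem_FP _) (c := 2 * C + 2) fun v => ?_
  rw [snocStep_eq, List.length_append, length_boolPair]
  have h1 := hC (boolPair (fstF (fstF v)) (fstF (sndF v)))
  rw [fstF_boolPair, sndF_boolPair] at h1
  have h2 := length_fstF_sndF_le (fstF v)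
  have e1 : sndPow 1 v = sndF (sndF v) := rfl
  rw [e1]
  simp only [List.length_nil]
  nlinarith [h1, h2]

/-- A clipped item function qualifies for `mapAppFn_mem_FP`. [folklore] -/
theorem mapAppFn_clipF_mem_FP (C : ℕ) {g : List Bool → List Bool} (hg : g ∈ FP) : mapAppFn (clipF C g) ∈ FP :=
  mapAppFn_mem_FP (clipF_mem_FP C hg) (C := C) fun z => (length_clipF_le C g z).trans (Nat.le_add_left _ _)

/-- The step `acc ++ 1` of the unary item counter. [folklore] -/
noncomputable def tickStep : List Bool → List Bool := appF ∘ fanoutFn (sndPow 1) (fun _ => [true])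

/-- `tickStep ∈ FP`. [folklore] -/
theorem tickStep_mem_FP : tickStep ∈ FP :=
  comp_mem_FP appF_mem_FP (fanoutFn_mem_FP (sndPow_mem_FP 1) (const_mem_FP _))

/-- Value of `tickStep`. [folklore] -/
theorem tickStep_eq (v : List Bool) : tickStep v = sndPow 1 v ++ [true] := by simp [tickStep]

/-- **`ucountFn ⟨x, L⟩ = 1^{#items of L}`**: the number of items of a coded list, in unary. [folklore] -/
noncomputable def ucountFn : List Bool → List Bool := foldFn tickStep (fun _ => [])

/-- `ucountFn ∈ FP`. [folklore] -/
theorem ucountFn_mem_FP : ucountFn ∈ FP :=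
  foldFn_mem_FP tickStep_mem_FP (const_mem_FP _) (c := 1) fun v => by
    rw [tickStep_eq, List.length_append]
    have e1 : sndPow 1 v = sndF (sndF v) := rfl
    rw [e1, List.length_singleton]; omega

/-- **Value of `ucountFn` on a pair.** [folklore] -/
theorem ucountFn_boolPair (x L : List Bool) : ucountFn (boolPair x L) = ones (decNil L).length := by
  rw [ucountFn, foldFn_boolPair]
  have key : ∀ (l : List (List Bool)) (k : ℕ),
      l.foldl (fun acc a => tickStep (boolPair (boolPair x L) (boolPair a acc))) (ones k) = ones (k + l.length) := by
    intro l
    induction l with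
    | nil => intro k; simp
    | cons a l ih =>
      intro k
      rw [List.foldl_cons, tickStep_eq]
      have : sndPow 1 (boolPair (boolPair x L) (boolPair a (ones k))) ++ [true] = ones (k + 1) := by
        simp [sndPow, ones, List.replicate_succ']
      rw [this, ih]
      simp [Nat.add_assoc, Nat.add_comm 1]
  simpa using key (decNil L) 0

/-- Value of `ucountFn` on `⟨x, encList l⟩`. [folklore] -/
theorem ucountFn_encList (x : List Bool) (l : List (List Bool)) : ucountFn (boolPair x (encList l)) = ones l.length := by
  rw [ucountFn_boolPair, decNil_encList]

/-- **Table lookup**: the `FP` function `bin x ↦ bin (a x)` for a function `a : ℕ → ℕ` vanishing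
from `N` on (a finite case distinction on the value `⟦v⟧`, by `eqValFn` against the constants
`bin 0, …, bin (N-1)`; default `bin 0 = ε`). [cite: AroraBarak2009, §2.1 (hard-wiring finitely many values)] -/
noncomputable def lookTab (a : ℕ → ℕ) : ℕ → List Bool → List Bool
  | 0 => fun _ => []
  | N + 1 => iteFn (eqValFn ∘ fanoutFn id (fun _ => encodeNat N)) (fun _ => encodeNat (a N)) (lookTab a N)

/-- `lookTab a N ∈ FP`. [folklore] -/
theorem lookTab_mem_FP (a : ℕ → ℕ) : ∀ N, lookTab a N ∈ FP
  | 0 => const_mem_FP _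
  | N + 1 => iteFn_mem_FP (comp_mem_FP eqValFn_mem_FP (fanoutFn_mem_FP OracleCompose.id_mem_FP (const_mem_FP _)))
      (const_mem_FP _) (lookTab_mem_FP a N)

/-- **Value of the table lookup** on every input. [folklore] -/
theorem lookTab_apply (a : ℕ → ℕ) : ∀ (N : ℕ) (v : List Bool),
    lookTab a N v = if bitsToNat v < N then encodeNat (a (bitsToNat v)) else []
  | 0, v => by simp [lookTab]
  | N + 1, v => by
    rw [lookTab, iteFn_apply (b := decide (bitsToNat v = N)) (by simp)]
    by_cases hv : bitsToNat v = N
    · rw [if_pos (by simp [hv]), if_pos (by omega), hv]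
    · rw [if_neg (by simp [hv]), lookTab_apply a N v]
      by_cases hlt : bitsToNat v < N
      · rw [if_pos hlt, if_pos (by omega)]
      · rw [if_neg hlt, if_neg (by omega)]

/-- The table computes `bin x ↦ bin (a x)` for `a` vanishing from `N` on. [folklore] -/
theorem lookTab_apply_of_vanishing {a : ℕ → ℕ} {N : ℕ} (h : ∀ x, N ≤ x → a x = 0) (v : List Bool) :
    lookTab a N v = encodeNat (a (bitsToNat v)) := by
  rw [lookTab_apply]
  split_ifs with hlt
  · rfl
  · rw [h _ (not_lt.1 hlt)]; rfl

/-- The values of the table are as short as its entries. [folklore] -/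
theorem length_lookTab_le {a : ℕ → ℕ} {K : ℕ} (hK : ∀ x, (encodeNat (a x)).length ≤ K) (N : ℕ) (v : List Bool) :
    (lookTab a N v).length ≤ K := by
  rw [lookTab_apply]
  split_ifs
  · exact hK _
  · exact Nat.zero_le _

/-! ### Reading the fields of a constraint code -/

/-- The coded variable list of a constraint code. [folklore] -/
@[simp] theorem sndF_fstF_ccode (C : CSPConstraint) : sndF (fstF (ccode C)) = encList (C.vars.map encodeNat) := by
  simp [ccode, vcode]

/-- The unary header of the variable list. [folklore] -/
@[simp] theorem fstF_fstF_ccode (C : CSPConstraint) : fstF (fstF (ccode C)) = ones C.vars.length := by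
  simp [ccode, vcode]

/-- The coded list of accepting rows. [folklore] -/
@[simp] theorem sndF_sndF_ccode (C : CSPConstraint) : sndF (sndF (ccode C)) = encList (C.accepting.map vcode) := by
  simp [ccode, acode]

/-- The unary header of the accepting rows. [folklore] -/
@[simp] theorem fstF_sndF_ccode (C : CSPConstraint) : fstF (sndF (ccode C)) = ones C.accepting.length := by
  simp [ccode, acode]

/-- The header of a row code. [folklore] -/
@[simp] theorem fstF_vcode (l : List ℕ) : fstF (vcode l) = ones l.length := by simp [vcode]

/-- The values of a row code. [folklore] -/
@[simp] theorem sndF_vcode (l : List ℕ) : sndF (vcode l) = encList (l.map encodeNat) := by simp [vcode]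

/-! ### The small-instance test: well-formedness and the size bounds -/

/-- `ltSwapFn ⟨a, b⟩ = [⟦b⟧ < ⟦a⟧]`. [folklore] -/
noncomputable def ltSwapFn : List Bool → List Bool := ltFn ∘ fanoutFn sndF fstF

/-- `ltSwapFn ∈ FP`. [folklore] -/
theorem ltSwapFn_mem_FP : ltSwapFn ∈ FP := comp_mem_FP ltFn_mem_FP (fanoutFn_mem_FP sndF_mem_FP fstF_mem_FP)

/-- `ltSwapFn` is one-bit. [folklore] -/
theorem oneBit_ltSwapFn : OneBit ltSwapFn := oneBit_ltFn.comp _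

/-- Value of `ltSwapFn` on a pair. [folklore] -/
@[simp] theorem ltSwapFn_boolPair (a b : List Bool) : ltSwapFn (boolPair a b) = [decide (bitsToNat b < bitsToNat a)] := by
  simp [ltSwapFn]

/-- On `⟨w, c⟩`: the bit "every variable of the constraint `c` is below field `0` of `w`".
[cite: Hirahara2022PartialMCSP, proof of Thm. 5.2 (p. 16, dom(r) ⊆ [n])] -/
noncomputable def varsLtF : List Bool → List Bool := allFn ltSwapFn ∘ fanoutFn (nthF 0 ∘ fstF) (sndF ∘ fstF ∘ sndF)

/-- `varsLtF ∈ FP`. [folklore] -/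
theorem varsLtF_mem_FP : varsLtF ∈ FP :=
  comp_mem_FP (allFn_mem_FP ltSwapFn_mem_FP oneBit_ltSwapFn)
    (fanoutFn_mem_FP (comp_mem_FP (nthF_mem_FP 0) fstF_mem_FP) (comp_mem_FP sndF_mem_FP (comp_mem_FP fstF_mem_FP sndF_mem_FP)))

/-- `varsLtF` is one-bit. [folklore] -/
theorem oneBit_varsLtF : OneBit varsLtF := (oneBit_allFn oneBit_ltSwapFn).comp _

/-- Value of `varsLtF` on `⟨w, ccode C⟩`. [folklore] -/
theorem varsLtF_apply (w : List Bool) (C : CSPConstraint) :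
    varsLtF (boolPair w (ccode C)) = [decide (∀ x ∈ C.vars, x < bitsToNat (nthF 0 w))] := by
  simp only [varsLtF, Function.comp_apply, fanoutFn_apply, fstF_boolPair, sndF_boolPair, sndF_fstF_ccode]
  rw [allFn_boolPair oneBit_ltSwapFn, decNil_encList]
  simp

/-- On `⟨w, c⟩`: the bit "the variables of `c` are pairwise distinct". [cite: Hirahara2022PartialMCSP, proof of Thm. 5.2 (p. 16)] -/
noncomputable def varsNodupF : List Bool → List Bool := nodupFn ∘ fanoutFn (fun _ => []) (sndF ∘ fstF ∘ sndF)

/-- `varsNodupF ∈ FP`. [folklore] -/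
theorem varsNodupF_mem_FP : varsNodupF ∈ FP :=
  comp_mem_FP nodupFn_mem_FP (fanoutFn_mem_FP (const_mem_FP _) (comp_mem_FP sndF_mem_FP (comp_mem_FP fstF_mem_FP sndF_mem_FP)))

/-- `varsNodupF` is one-bit. [folklore] -/
theorem oneBit_varsNodupF : OneBit varsNodupF := oneBit_nodupFn.comp _

/-- Value of `varsNodupF` on `⟨w, ccode C⟩`. [folklore] -/
theorem varsNodupF_apply (w : List Bool) (C : CSPConstraint) :
    varsNodupF (boolPair w (ccode C)) = [decide C.vars.Nodup] := by
  obtain ⟨b, hb⟩ := oneBit_varsNodupF (boolPair w (ccode C))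
  rw [hb]
  have h : varsNodupF (boolPair w (ccode C)) = [true] ↔ C.vars.Nodup := by
    simp only [varsNodupF, Function.comp_apply, fanoutFn_apply, sndF_boolPair, sndF_fstF_ccode]
    rw [nodupFn_encList_eq_true, List.nodup_map_iff fun a b h => encodeNat_inj.1 h]
  rw [hb] at h
  cases b
  · simp only [List.cons.injEq, and_true, Bool.false_eq_true, false_iff] at h
    simp [h]
  · simp only [true_iff] at h
    simp [h]

/-- On `⟨w, c⟩`: the bit "the accepting rows of `c` are pairwise distinct". [cite: Hirahara2022PartialMCSP, proof of Thm. 5.2 (p. 16)] -/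
noncomputable def accNodupF : List Bool → List Bool := nodupFn ∘ fanoutFn (fun _ => []) (sndF ∘ sndF ∘ sndF)

/-- `accNodupF ∈ FP`. [folklore] -/
theorem accNodupF_mem_FP : accNodupF ∈ FP :=
  comp_mem_FP nodupFn_mem_FP (fanoutFn_mem_FP (const_mem_FP _) (comp_mem_FP sndF_mem_FP (comp_mem_FP sndF_mem_FP sndF_mem_FP)))

/-- `accNodupF` is one-bit. [folklore] -/
theorem oneBit_accNodupF : OneBit accNodupF := oneBit_nodupFn.comp _

/-- Value of `accNodupF` on `⟨w, ccode C⟩`. [folklore] -/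
theorem accNodupF_apply (w : List Bool) (C : CSPConstraint) :
    accNodupF (boolPair w (ccode C)) = [decide C.accepting.Nodup] := by
  obtain ⟨b, hb⟩ := oneBit_accNodupF (boolPair w (ccode C))
  rw [hb]
  have h : accNodupF (boolPair w (ccode C)) = [true] ↔ C.accepting.Nodup := by
    simp only [accNodupF, Function.comp_apply, fanoutFn_apply, sndF_boolPair, sndF_sndF_ccode]
    rw [nodupFn_encList_eq_true, List.nodup_map_iff fun a b h => vcode_inj.1 h]
  rw [hb] at h
  cases b
  · simp only [List.cons.injEq, and_true, Bool.false_eq_true, false_iff] at h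
    simp [h]
  · simp only [true_iff] at h
    simp [h]

/-- On `⟨⟨bin q, 1ᵈ⟩, rc⟩`: the bit "the row `rc` has length `d` and values below `q`". [cite: Hirahara2022PartialMCSP, proof of Thm. 5.2 (p. 16, r : dom(r) → Σ)] -/
noncomputable def rowOkF : List Bool → List Bool :=
  andFn (eqPairFn ∘ fanoutFn (sndF ∘ fstF) (fstF ∘ sndF)) (allFn ltSwapFn ∘ fanoutFn (fstF ∘ fstF) (sndF ∘ sndF))

/-- `rowOkF ∈ FP`. [folklore] -/
theorem rowOkF_mem_FP : rowOkF ∈ FP :=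
  andFn_mem_FP (comp_mem_FP eqPairFn_mem_FP (fanoutFn_mem_FP (comp_mem_FP sndF_mem_FP fstF_mem_FP) (comp_mem_FP fstF_mem_FP sndF_mem_FP)))
    (comp_mem_FP (allFn_mem_FP ltSwapFn_mem_FP oneBit_ltSwapFn)
      (fanoutFn_mem_FP (comp_mem_FP fstF_mem_FP fstF_mem_FP) (comp_mem_FP sndF_mem_FP sndF_mem_FP)))

/-- `rowOkF` is one-bit. [folklore] -/
theorem oneBit_rowOkF : OneBit rowOkF := oneBit_andFn (oneBit_eqPairFn.comp _) ((oneBit_allFn oneBit_ltSwapFn).comp _)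

/-- Value of `rowOkF` on `⟨⟨bin q, 1ᵈ⟩, vcode r⟩`. [folklore] -/
theorem rowOkF_apply (qb : List Bool) (d : ℕ) (r : List ℕ) :
    rowOkF (boolPair (boolPair qb (ones d)) (vcode r)) = [decide (r.length = d ∧ ∀ v ∈ r, v < bitsToNat qb)] := by
  rw [rowOkF, andFn_apply (b := decide (r.length = d)) (b' := decide (∀ v ∈ r, v < bitsToNat qb))]
  · simp [Bool.decide_and]
  · simp only [Function.comp_apply, fanoutFn_apply, fstF_boolPair, sndF_boolPair, fstF_vcode, eqPairFn_boolPair]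
    congr 1
    apply Bool.decide_congr
    exact ⟨fun h => by simpa [ones] using (congrArg List.length h).symm, fun h => by rw [h]⟩
  · simp only [Function.comp_apply, fanoutFn_apply, fstF_boolPair, sndF_boolPair, sndF_vcode]
    rw [allFn_boolPair oneBit_ltSwapFn, decNil_encList]
    simp

/-- On `⟨w, c⟩`: the bit "every accepting row of `c` has the length of `vars` and values below
field `1` of `w`". [cite: Hirahara2022PartialMCSP, proof of Thm. 5.2 (p. 16)] -/
noncomputable def rowsOkF : List Bool → List Bool :=
  allFn rowOkF ∘ fanoutFn (fanoutFn (nthF 1 ∘ fstF) (fstF ∘ fstF ∘ sndF)) (sndF ∘ sndF ∘ sndF)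

/-- `rowsOkF ∈ FP`. [folklore] -/
theorem rowsOkF_mem_FP : rowsOkF ∈ FP :=
  comp_mem_FP (allFn_mem_FP rowOkF_mem_FP oneBit_rowOkF)
    (fanoutFn_mem_FP (fanoutFn_mem_FP (comp_mem_FP (nthF_mem_FP 1) fstF_mem_FP) (comp_mem_FP fstF_mem_FP (comp_mem_FP fstF_mem_FP sndF_mem_FP)))
      (comp_mem_FP sndF_mem_FP (comp_mem_FP sndF_mem_FP sndF_mem_FP)))

/-- `rowsOkF` is one-bit. [folklore] -/
theorem oneBit_rowsOkF : OneBit rowsOkF := (oneBit_allFn oneBit_rowOkF).comp _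

/-- Value of `rowsOkF` on `⟨w, ccode C⟩`. [folklore] -/
theorem rowsOkF_apply (w : List Bool) (C : CSPConstraint) :
    rowsOkF (boolPair w (ccode C)) =
      [decide (∀ r ∈ C.accepting, r.length = C.vars.length ∧ ∀ v ∈ r, v < bitsToNat (nthF 1 w))] := by
  simp only [rowsOkF, Function.comp_apply, fanoutFn_apply, fstF_boolPair, sndF_boolPair, sndF_sndF_ccode, fstF_fstF_ccode]
  rw [allFn_boolPair oneBit_rowOkF, decNil_encList]
  congr 1
  apply Bool.decide_congr
  simp only [List.forall_mem_map, rowOkF_apply, List.cons.injEq, and_true, decide_eq_true_eq]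

/-- On `⟨w, c⟩`: the bit "`c` is a well-formed constraint over `n = ⟦field 0⟧` variables and the
alphabet `[⟦field 1⟧]`" (`CSPConstraint.WellFormed`). [cite: Hirahara2022PartialMCSP, proof of Thm. 5.2 (p. 16)] -/
noncomputable def cwfF : List Bool → List Bool := andFn varsLtF (andFn varsNodupF (andFn accNodupF rowsOkF))

/-- `cwfF ∈ FP`. [folklore] -/
theorem cwfF_mem_FP : cwfF ∈ FP :=
  andFn_mem_FP varsLtF_mem_FP (andFn_mem_FP varsNodupF_mem_FP (andFn_mem_FP accNodupF_mem_FP rowsOkF_mem_FP))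

/-- `cwfF` is one-bit. [folklore] -/
theorem oneBit_cwfF : OneBit cwfF :=
  oneBit_andFn oneBit_varsLtF (oneBit_andFn oneBit_varsNodupF (oneBit_andFn oneBit_accNodupF oneBit_rowsOkF))

/-- **Value of `cwfF` on `⟨w, ccode C⟩`**: the well-formedness of `C`. [folklore] -/
theorem cwfF_apply (w : List Bool) (C : CSPConstraint) :
    cwfF (boolPair w (ccode C)) = [decide (C.WellFormed (bitsToNat (nthF 0 w)) (bitsToNat (nthF 1 w)))] := by
  rw [cwfF, andFn_apply (varsLtF_apply w C) (andFn_apply (varsNodupF_apply w C)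
    (andFn_apply (accNodupF_apply w C) (rowsOkF_apply w C)))]
  simp only [CSPConstraint.WellFormed, Bool.decide_and]

/-- The bit "field `i` of the input is at most the constant `K`". [folklore] -/
noncomputable def leConstF (K i : ℕ) : List Bool → List Bool := notFn (ltFn ∘ fanoutFn (fun _ => encodeNat K) (nthF i))

/-- `leConstF K i ∈ FP`. [folklore] -/
theorem leConstF_mem_FP (K i : ℕ) : leConstF K i ∈ FP :=
  notFn_mem_FP (comp_mem_FP ltFn_mem_FP (fanoutFn_mem_FP (const_mem_FP _) (nthF_mem_FP i)))

/-- `leConstF K i` is one-bit. [folklore] -/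
theorem oneBit_leConstF (K i : ℕ) : OneBit (leConstF K i) := oneBit_notFn (oneBit_ltFn.comp _)

/-- Value of `leConstF`. [folklore] -/
theorem leConstF_apply (K i : ℕ) (w : List Bool) : leConstF K i w = [decide (bitsToNat (nthF i w) ≤ K)] := by
  rw [leConstF, notFn_apply (b := decide (K < bitsToNat (nthF i w))) (by simp)]
  congr 1
  by_cases h : bitsToNat (nthF i w) ≤ K
  · simp [h, not_lt.2 h]
  · simp [h, not_le.1 h]

/-- **The well-formedness test** on the whole input: at least one constraint, and every constraint
well formed. [cite: Hirahara2022PartialMCSP, proof of Thm. 5.2 (p. 16)] -/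
noncomputable def wfF : List Bool → List Bool :=
  andFn (notFn (isNilFn ∘ sndPow 2)) (allFn cwfF ∘ fanoutFn id (sndPow 2))

/-- `wfF ∈ FP`. [folklore] -/
theorem wfF_mem_FP : wfF ∈ FP :=
  andFn_mem_FP (notFn_mem_FP (comp_mem_FP isNilFn_mem_FP (sndPow_mem_FP 2)))
    (comp_mem_FP (allFn_mem_FP cwfF_mem_FP oneBit_cwfF) (fanoutFn_mem_FP OracleCompose.id_mem_FP (sndPow_mem_FP 2)))

/-- `wfF` is one-bit. [folklore] -/
theorem oneBit_wfF : OneBit wfF := oneBit_andFn (oneBit_notFn (oneBit_isNilFn.comp _)) ((oneBit_allFn oneBit_cwfF).comp _)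

/-- **Value of `wfF` on an instance code**: `Ψ.WellFormed`. [folklore] -/
theorem wfF_icode (Ψ : CSPInstance) : wfF (icode Ψ) = [decide Ψ.WellFormed] := by
  have h1 : (notFn (isNilFn ∘ sndPow 2)) (icode Ψ) = [decide (0 < Ψ.numConstraints)] := by
    rw [notFn_apply (b := decide (Ψ.constraints.map ccode = [])) (by simp [isNilFn_encList])]
    simp [CSPInstance.numConstraints, List.length_pos_iff]
  have h2 : (allFn cwfF ∘ fanoutFn id (sndPow 2)) (icode Ψ) =
      [decide (∀ C ∈ Ψ.constraints, C.WellFormed Ψ.numVars Ψ.alphabetSize)] := by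
    simp only [Function.comp_apply, fanoutFn_apply, id, sndPow_two_icode]
    rw [allFn_boolPair oneBit_cwfF, decNil_encList]
    congr 1
    apply Bool.decide_congr
    simp only [List.forall_mem_map, cwfF_apply, nthF_zero_icode, nthF_one_icode, bitsToNat_encodeNat,
      List.cons.injEq, and_true, decide_eq_true_eq]
  rw [wfF, andFn_apply h1 h2]
  simp [CSPInstance.WellFormed, Bool.decide_and]

/-- **The small-instance test** `WellFormed ∧ n ≤ N₀ ∧ |Σ| ≤ Q₀`. [cite: Hirahara2022PartialMCSP, proof of Thm. 5.2 (p. 16); AroraBarak2009, §2.1 (finite patch)] -/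
noncomputable def smallFn (N₀ Q₀ : ℕ) : List Bool → List Bool := andFn wfF (andFn (leConstF N₀ 0) (leConstF Q₀ 1))

/-- `smallFn N₀ Q₀ ∈ FP`. [folklore] -/
theorem smallFn_mem_FP (N₀ Q₀ : ℕ) : smallFn N₀ Q₀ ∈ FP :=
  andFn_mem_FP wfF_mem_FP (andFn_mem_FP (leConstF_mem_FP N₀ 0) (leConstF_mem_FP Q₀ 1))

/-- `smallFn N₀ Q₀` is one-bit. [folklore] -/
theorem oneBit_smallFn (N₀ Q₀ : ℕ) : OneBit (smallFn N₀ Q₀) :=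
  oneBit_andFn oneBit_wfF (oneBit_andFn (oneBit_leConstF N₀ 0) (oneBit_leConstF Q₀ 1))

/-- **Value of the small-instance test on an instance code.** [folklore] -/
theorem smallFn_icode (N₀ Q₀ : ℕ) (Ψ : CSPInstance) :
    smallFn N₀ Q₀ (icode Ψ) = [decide (Ψ.WellFormed ∧ Ψ.numVars ≤ N₀ ∧ Ψ.alphabetSize ≤ Q₀)] := by
  rw [smallFn, andFn_apply (wfF_icode Ψ) (andFn_apply (leConstF_apply N₀ 0 _) (leConstF_apply Q₀ 1 _))]
  simp [Bool.decide_and]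

/-! ### The small-instance solver: brute force over finitely many assignments -/

/-- The candidate assignments `[N] → [Q+1]`, extended by `0` (as total functions `ℕ → ℕ`).
[cite: AroraBarak2009, §2.1 (finitely many instances hard-wired)] -/
def cands : ℕ → ℕ → List (ℕ → ℕ)
  | 0, _ => [fun _ => 0]
  | N + 1, Q => (cands N Q).flatMap fun a => (List.range (Q + 1)).map fun v => Function.update a N v

/-- Candidates vanish from `N` on. [folklore] -/
theorem cands_vanish : ∀ {N Q : ℕ} {a : ℕ → ℕ}, a ∈ cands N Q → ∀ x, N ≤ x → a x = 0
  | 0, Q, a, h, x, _ => by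
    simp only [cands, List.mem_singleton] at h
    subst h; rfl
  | N + 1, Q, a, h, x, hx => by
    simp only [cands, List.mem_flatMap, List.mem_map, List.mem_range] at h
    obtain ⟨a', ha', v, -, rfl⟩ := h
    rw [Function.update_of_ne (by omega)]
    exact cands_vanish ha' x (by omega)

/-- Candidates take values at most `Q`. [folklore] -/
theorem cands_le : ∀ {N Q : ℕ} {a : ℕ → ℕ}, a ∈ cands N Q → ∀ x, a x ≤ Q
  | 0, Q, a, h, x => by
    simp only [cands, List.mem_singleton] at h
    subst h; exact Nat.zero_le _
  | N + 1, Q, a, h, x => by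
    simp only [cands, List.mem_flatMap, List.mem_map, List.mem_range] at h
    obtain ⟨a', ha', v, hv, rfl⟩ := h
    by_cases hx : x = N
    · subst hx; rw [Function.update_self]; omega
    · rw [Function.update_of_ne hx]; exact cands_le ha' x

/-- **Every assignment, clipped to `[N] → [Q+1]`, is a candidate.** [folklore] -/
theorem clip_mem_cands (b : ℕ → ℕ) (Q : ℕ) : ∀ N : ℕ, (fun x => if x < N then min (b x) Q else 0) ∈ cands N Q
  | 0 => by simp [cands]
  | N + 1 => by
    simp only [cands, List.mem_flatMap, List.mem_map, List.mem_range]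
    refine ⟨_, clip_mem_cands b Q N, min (b N) Q, by omega, ?_⟩
    funext x
    by_cases hx : x = N
    · subst hx; simp
    · rw [Function.update_of_ne hx]
      by_cases h1 : x < N
      · simp [h1, show x < N + 1 by omega]
      · simp [h1, show ¬ x < N + 1 by omega]

/-- **Satisfiability of a small well-formed instance is witnessed by a candidate**: values `≥ q`
never occur in an accepting row and variables `≥ n` never occur in a constraint.
[cite: Hirahara2022PartialMCSP, proof of Thm. 5.2 (p. 17, "Ψ is satisfied by an assignment α : [n] → Σ")] -/
theorem isSatisfiable_iff_cands {Ψ : CSPInstance} {N Q : ℕ} (hwf : Ψ.WellFormed) (hN : Ψ.numVars ≤ N)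
    (hQ : Ψ.alphabetSize ≤ Q) :
    Ψ.IsSatisfiable ↔ ∃ a ∈ cands N Q, ∀ C ∈ Ψ.constraints, C.IsSatisfiedBy a = true := by
  constructor
  · rintro ⟨b, hb⟩
    refine ⟨_, clip_mem_cands b Q N, fun C hC => ?_⟩
    have hsat := hb C hC
    rw [CSPConstraint.isSatisfiedBy_eq_true_iff] at hsat ⊢
    have hwC := hwf.2 C hC
    have heq : C.vars.map (fun x => if x < N then min (b x) Q else 0) = C.vars.map b := by
      refine List.map_congr_left fun x hx => ?_
      have hxn : x < N := (hwC.1 x hx).trans_le hN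
      have hbx : b x < Q :=
        ((hwC.2.2.2 _ hsat).2 (b x) (List.mem_map.2 ⟨x, hx, rfl⟩)).trans_le hQ
      simp [hxn, Nat.min_eq_left hbx.le]
    rw [heq]; exact hsat
  · rintro ⟨a, -, ha⟩
    exact ⟨a, ha⟩

/-- The code of the local view `vars.map a`: on `⟨x, [bin v]_v⟩`, the coded list `[bin (a v)]_v`
(table lookup mapped over the items). [cite: AroraBarak2009, §1.3 (bounded loops)] -/
noncomputable def imgF (a : ℕ → ℕ) (N : ℕ) : List Bool → List Bool := mapAppFn (lookTab a N ∘ sndF)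

/-- `imgF a N ∈ FP` (the table values are bounded). [folklore] -/
theorem imgF_mem_FP (a : ℕ → ℕ) (N : ℕ) {Q : ℕ} (hQ : ∀ x, a x ≤ Q) : imgF a N ∈ FP :=
  mapAppFn_mem_FP (comp_mem_FP (lookTab_mem_FP a N) sndF_mem_FP) (C := (encodeNat Q).length) fun z =>
    (length_lookTab_le (fun x => length_encodeNat_mono (hQ x)) N (sndF z)).trans
      (by nlinarith [Nat.zero_le (sndF z).length, Nat.zero_le (fstF z).length])

/-- **Value of `imgF`** on a coded variable list, for `a` vanishing from `N` on. [folklore] -/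
theorem imgF_apply {a : ℕ → ℕ} {N : ℕ} (ha : ∀ x, N ≤ x → a x = 0) (x : List Bool) (l : List ℕ) :
    imgF a N (boolPair x (encList (l.map encodeNat))) = encList ((l.map a).map encodeNat) := by
  rw [imgF, mapAppFn_encList, List.map_map, List.map_map]
  congr 1
  refine List.map_congr_left fun v _ => ?_
  simp [lookTab_apply_of_vanishing ha]

/-- On `⟨img, rc⟩`: the bit "the values of the row `rc` are the coded list `img`". [folklore] -/
noncomputable def rowEqF : List Bool → List Bool := eqPairFn ∘ fanoutFn fstF (sndF ∘ sndF)

/-- `rowEqF ∈ FP`. [folklore] -/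
theorem rowEqF_mem_FP : rowEqF ∈ FP :=
  comp_mem_FP eqPairFn_mem_FP (fanoutFn_mem_FP fstF_mem_FP (comp_mem_FP sndF_mem_FP sndF_mem_FP))

/-- `rowEqF` is one-bit. [folklore] -/
theorem oneBit_rowEqF : OneBit rowEqF := oneBit_eqPairFn.comp _

/-- Value of `rowEqF` on `⟨img, vcode r⟩`. [folklore] -/
@[simp] theorem rowEqF_apply (img : List Bool) (r : List ℕ) :
    rowEqF (boolPair img (vcode r)) = [decide (img = encList (r.map encodeNat))] := by
  simp [rowEqF]
  exact eqPairFn_boolPair _ _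

/-- On `⟨w, c⟩`: the bit "the candidate `a` satisfies the constraint `c`" (its local view is one of
the accepting rows). [cite: Hirahara2022PartialMCSP, proof of Thm. 5.2 (p. 16, C⁻¹(1))] -/
noncomputable def cSatF (a : ℕ → ℕ) (N : ℕ) : List Bool → List Bool :=
  anyFn rowEqF ∘ fanoutFn (imgF a N ∘ fanoutFn (fun _ => []) (sndF ∘ fstF ∘ sndF)) (sndF ∘ sndF ∘ sndF)

/-- `cSatF a N ∈ FP`. [folklore] -/
theorem cSatF_mem_FP (a : ℕ → ℕ) (N : ℕ) {Q : ℕ} (hQ : ∀ x, a x ≤ Q) : cSatF a N ∈ FP :=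
  comp_mem_FP (anyFn_mem_FP rowEqF_mem_FP oneBit_rowEqF)
    (fanoutFn_mem_FP (comp_mem_FP (imgF_mem_FP a N hQ) (fanoutFn_mem_FP (const_mem_FP _)
      (comp_mem_FP sndF_mem_FP (comp_mem_FP fstF_mem_FP sndF_mem_FP))))
      (comp_mem_FP sndF_mem_FP (comp_mem_FP sndF_mem_FP sndF_mem_FP)))

/-- `cSatF a N` is one-bit. [folklore] -/
theorem oneBit_cSatF (a : ℕ → ℕ) (N : ℕ) : OneBit (cSatF a N) := (oneBit_anyFn oneBit_rowEqF).comp _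

/-- **Value of `cSatF` on `⟨w, ccode C⟩`**: `C.IsSatisfiedBy a`. [folklore] -/
theorem cSatF_apply {a : ℕ → ℕ} {N : ℕ} (ha : ∀ x, N ≤ x → a x = 0) (w : List Bool) (C : CSPConstraint) :
    cSatF a N (boolPair w (ccode C)) = [C.IsSatisfiedBy a] := by
  simp only [cSatF, Function.comp_apply, fanoutFn_apply, sndF_boolPair, sndF_fstF_ccode, sndF_sndF_ccode,
    imgF_apply ha]
  rw [anyFn_boolPair oneBit_rowEqF, decNil_encList, CSPConstraint.IsSatisfiedBy]
  congr 1
  apply Bool.decide_congr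
  simp only [List.mem_map, exists_exists_and_eq_and, rowEqF_apply, List.cons.injEq, and_true, decide_eq_true_eq, encList_inj]
  constructor
  · rintro ⟨r, hr, h⟩
    rwa [List.map_injective_iff.2 (fun a b hab => encodeNat_inj.1 hab) h]
  · intro h
    exact ⟨_, h, rfl⟩

/-- The bit "the candidate `a` satisfies every constraint of the input". [folklore] -/
noncomputable def candF (a : ℕ → ℕ) (N : ℕ) : List Bool → List Bool := allFn (cSatF a N) ∘ fanoutFn id (sndPow 2)

/-- `candF a N ∈ FP`. [folklore] -/
theorem candF_mem_FP (a : ℕ → ℕ) (N : ℕ) {Q : ℕ} (hQ : ∀ x, a x ≤ Q) : candF a N ∈ FP :=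
  comp_mem_FP (allFn_mem_FP (cSatF_mem_FP a N hQ) (oneBit_cSatF a N)) (fanoutFn_mem_FP OracleCompose.id_mem_FP (sndPow_mem_FP 2))

/-- `candF a N` is one-bit. [folklore] -/
theorem oneBit_candF (a : ℕ → ℕ) (N : ℕ) : OneBit (candF a N) := (oneBit_allFn (oneBit_cSatF a N)).comp _

/-- **Value of `candF` on an instance code.** [folklore] -/
theorem candF_icode {a : ℕ → ℕ} {N : ℕ} (ha : ∀ x, N ≤ x → a x = 0) (Ψ : CSPInstance) :
    candF a N (icode Ψ) = [decide (∀ C ∈ Ψ.constraints, C.IsSatisfiedBy a = true)] := by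
  simp only [candF, Function.comp_apply, fanoutFn_apply, id, sndPow_two_icode]
  rw [allFn_boolPair (oneBit_cSatF a N), decNil_encList]
  congr 1
  apply Bool.decide_congr
  simp only [List.forall_mem_map, cSatF_apply ha, List.cons.injEq, and_true]

/-- A finite disjunction of one-bit tests. [folklore] -/
noncomputable def orList : List (List Bool → List Bool) → List Bool → List Bool
  | [] => fun _ => [false]
  | f :: fs => orFn f (orList fs)

/-- `orList fs ∈ FP` for `fs ⊆ FP`. [folklore] -/
theorem orList_mem_FP : ∀ {fs : List (List Bool → List Bool)}, (∀ f ∈ fs, f ∈ FP) → orList fs ∈ FP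
  | [], _ => const_mem_FP _
  | f :: fs, h => orFn_mem_FP (h f (by simp)) (orList_mem_FP fun g hg => h g (by simp [hg]))

/-- `orList fs` is one-bit for one-bit `fs`. [folklore] -/
theorem oneBit_orList : ∀ {fs : List (List Bool → List Bool)}, (∀ f ∈ fs, OneBit f) → OneBit (orList fs)
  | [], _ => oneBit_const false
  | f :: fs, h => oneBit_orFn (h f (by simp)) (oneBit_orList fun g hg => h g (by simp [hg]))

/-- **Value of a finite disjunction.** [folklore] -/
theorem orList_apply : ∀ {fs : List (List Bool → List Bool)}, (∀ f ∈ fs, OneBit f) → ∀ w,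
    orList fs w = [decide (∃ f ∈ fs, f w = [true])]
  | [], _, w => by simp [orList]
  | f :: fs, h, w => by
    obtain ⟨b, hb⟩ := h f (by simp) w
    rw [orList, orFn_apply hb (orList_apply (fun g hg => h g (by simp [hg])) w)]
    congr 1
    apply Bool.eq_iff_iff.2
    simp only [Bool.or_eq_true, decide_eq_true_eq, List.mem_cons, exists_eq_or_imp, hb, List.cons.injEq,
      and_true]

/-- **The small-instance solver**: the bit "some candidate `[N₀] → [Q₀+1]` satisfies every
constraint". [cite: AroraBarak2009, §2.1 (finitely many instances hard-wired)] -/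
noncomputable def satFn (N₀ Q₀ : ℕ) : List Bool → List Bool := orList ((cands N₀ Q₀).map fun a => candF a N₀)

/-- `satFn N₀ Q₀ ∈ FP`. [folklore] -/
theorem satFn_mem_FP (N₀ Q₀ : ℕ) : satFn N₀ Q₀ ∈ FP :=
  orList_mem_FP fun f hf => by
    obtain ⟨a, ha, rfl⟩ := List.mem_map.1 hf
    exact candF_mem_FP a N₀ (cands_le ha)

/-- `satFn N₀ Q₀` is one-bit. [folklore] -/
theorem oneBit_satFn (N₀ Q₀ : ℕ) : OneBit (satFn N₀ Q₀) :=
  oneBit_orList fun f hf => by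
    obtain ⟨a, -, rfl⟩ := List.mem_map.1 hf
    exact oneBit_candF a N₀

open Classical in
/-- **Value of the solver on the code of a small well-formed instance**: `Ψ.IsSatisfiable`.
[cite: Hirahara2022PartialMCSP, proof of Thm. 5.2 (p. 17)] -/
theorem satFn_icode {N₀ Q₀ : ℕ} {Ψ : CSPInstance} (hwf : Ψ.WellFormed) (hN : Ψ.numVars ≤ N₀)
    (hQ : Ψ.alphabetSize ≤ Q₀) : satFn N₀ Q₀ (icode Ψ) = [decide Ψ.IsSatisfiable] := by
  rw [satFn, orList_apply (fun f hf => by obtain ⟨a, -, rfl⟩ := List.mem_map.1 hf; exact oneBit_candF a N₀)]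
  congr 1
  rw [Bool.decide_congr (isSatisfiable_iff_cands hwf hN hQ)]
  apply Bool.decide_congr
  simp only [List.mem_map, exists_exists_and_eq_and]
  refine exists_congr fun a => and_congr_right fun ha => ?_
  rw [candF_icode (cands_vanish ha)]
  simp

/-! ### The total arity and the size test `n, |Σ| ≤ Σⱼ |dom Cⱼ|` -/

/-- The step `acc ++ (header of the variable list of the item)`. [folklore] -/
noncomputable def totStep : List Bool → List Bool := appF ∘ fanoutFn (sndPow 1) (fstF ∘ fstF ∘ nthF 1)

/-- `totStep ∈ FP`. [folklore] -/
theorem totStep_mem_FP : totStep ∈ FP :=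
  comp_mem_FP appF_mem_FP (fanoutFn_mem_FP (sndPow_mem_FP 1) (comp_mem_FP fstF_mem_FP (comp_mem_FP fstF_mem_FP (nthF_mem_FP 1))))

/-- Value of `totStep` on every input. [folklore] -/
theorem totStep_eq (v : List Bool) : totStep v = sndPow 1 v ++ fstF (fstF (fstF (sndF v))) := by
  simp [totStep, nthF, sndPow]

/-- **`totUnF ⟨x, [c₁, …, c_m]⟩ = 1^{Σⱼ |dom Cⱼ|}`**: the total arity in unary (the concatenation
of the unary headers of the variable lists). [cite: Hirahara2022PartialMCSP, proof of Thm. 5.2 (p. 16, s := mD)] -/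
noncomputable def totUnF : List Bool → List Bool := foldFn totStep (fun _ => [])

/-- `totUnF ∈ FP`. [folklore] -/
theorem totUnF_mem_FP : totUnF ∈ FP :=
  foldFn_mem_FP totStep_mem_FP (const_mem_FP _) (c := 0) fun v => by
    rw [totStep_eq, List.length_append]
    have e1 : sndPow 1 v = sndF (sndF v) := rfl
    have h1 := length_fstF_sndF_le (fstF (sndF v))
    have h2 := length_fstF_sndF_le (fstF (fstF (sndF v)))
    rw [e1]; omega

/-- The left fold of `acc ++ 1^{g a}`. [folklore] -/
theorem foldl_append_ones {α : Type} (g : α → ℕ) : ∀ (l : List α) (k : ℕ),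
    l.foldl (fun acc a => acc ++ ones (g a)) (ones k) = ones (k + (l.map g).sum)
  | [], k => by simp
  | a :: l, k => by
    rw [List.foldl_cons, show ones k ++ ones (g a) = ones (k + g a) by simp [ones], foldl_append_ones g l]
    simp [Nat.add_assoc]

/-- **Value of `totUnF` on `⟨x, [ccode C]_C⟩`.** [folklore] -/
theorem totUnF_apply (x : List Bool) (cs : List CSPConstraint) :
    totUnF (boolPair x (encList (cs.map ccode))) = ones (cs.map fun C => C.vars.length).sum := by
  rw [totUnF, foldFn_boolPair, decNil_encList, List.foldl_map]
  have : (fun acc C => totStep (boolPair (boolPair x (encList (cs.map ccode))) (boolPair (ccode C) acc))) =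
      fun acc C => acc ++ ones C.vars.length := by
    funext acc C
    rw [totStep_eq]; simp [sndPow]
  rw [this]
  simpa using foldl_append_ones (fun C : CSPConstraint => C.vars.length) cs 0

/-- **`TbinF w = bin (Σⱼ |dom Cⱼ|)`** on instance codes: the threshold `s` in binary. [cite: Hirahara2022PartialMCSP, proof of Thm. 5.2 (p. 16, s := mD)] -/
noncomputable def TbinF : List Bool → List Bool := lenBinF ∘ totUnF ∘ fanoutFn id (sndPow 2)

/-- `TbinF ∈ FP`. [folklore] -/
theorem TbinF_mem_FP : TbinF ∈ FP :=
  comp_mem_FP lenBinF_mem_FP (comp_mem_FP totUnF_mem_FP (fanoutFn_mem_FP OracleCompose.id_mem_FP (sndPow_mem_FP 2)))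

/-- **Value of `TbinF` on an instance code.** [folklore] -/
@[simp] theorem TbinF_icode (Ψ : CSPInstance) : TbinF (icode Ψ) = encodeNat Ψ.totalArity := by
  simp only [TbinF, Function.comp_apply, fanoutFn_apply, id, sndPow_two_icode, totUnF_apply, lenBinF_apply]
  simp [CSPInstance.totalArity, ones]

/-- The bit "field `i` is at most the total arity". [folklore] -/
noncomputable def leTotF (i : ℕ) : List Bool → List Bool := notFn (ltFn ∘ fanoutFn TbinF (nthF i))

/-- `leTotF i ∈ FP`. [folklore] -/
theorem leTotF_mem_FP (i : ℕ) : leTotF i ∈ FP :=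
  notFn_mem_FP (comp_mem_FP ltFn_mem_FP (fanoutFn_mem_FP TbinF_mem_FP (nthF_mem_FP i)))

/-- `leTotF i` is one-bit. [folklore] -/
theorem oneBit_leTotF (i : ℕ) : OneBit (leTotF i) := oneBit_notFn (oneBit_ltFn.comp _)

/-- Value of `leTotF i` on an instance code. [folklore] -/
theorem leTotF_icode (i : ℕ) (Ψ : CSPInstance) :
    leTotF i (icode Ψ) = [decide (bitsToNat (nthF i (icode Ψ)) ≤ Ψ.totalArity)] := by
  rw [leTotF, notFn_apply (b := decide (Ψ.totalArity < bitsToNat (nthF i (icode Ψ)))) (by simp)]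
  congr 1
  by_cases h : bitsToNat (nthF i (icode Ψ)) ≤ Ψ.totalArity
  · simp [h, not_lt.2 h]
  · simp [h, not_le.1 h]

/-- **The size test** `n ≤ Σⱼ |dom Cⱼ| ∧ |Σ| ≤ Σⱼ |dom Cⱼ|` (under which the Dinur–Safra instance is
polynomially large; automatic when every variable is queried). [cite: Hirahara2022PartialMCSP, proof of Thm. 5.2 (p. 16)] -/
noncomputable def fitsFn : List Bool → List Bool := andFn (leTotF 0) (leTotF 1)

/-- `fitsFn ∈ FP`. [folklore] -/
theorem fitsFn_mem_FP : fitsFn ∈ FP := andFn_mem_FP (leTotF_mem_FP 0) (leTotF_mem_FP 1)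

/-- `fitsFn` is one-bit. [folklore] -/
theorem oneBit_fitsFn : OneBit fitsFn := oneBit_andFn (oneBit_leTotF 0) (oneBit_leTotF 1)

/-- **Value of the size test on an instance code.** [folklore] -/
theorem fitsFn_icode (Ψ : CSPInstance) :
    fitsFn (icode Ψ) = [decide (Ψ.numVars ≤ Ψ.totalArity ∧ Ψ.alphabetSize ≤ Ψ.totalArity)] := by
  rw [fitsFn, andFn_apply (leTotF_icode 0 Ψ) (leTotF_icode 1 Ψ)]
  simp [Bool.decide_and]

/-! ### The Dinur–Safra instance: the bricks -/

/-- The pad `1^{(|w|+1)^3}` of the yardstick. [folklore] -/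
noncomputable def cubePadF : List Bool → List Bool := polyFn ((X + 1) ^ 3)

/-- `cubePadF ∈ FP`. [folklore] -/
theorem cubePadF_mem_FP : cubePadF ∈ FP := polyFn_mem_FP _

/-- Value of `cubePadF`. [folklore] -/
@[simp] theorem cubePadF_apply (w : List Bool) : cubePadF w = ones ((w.length + 1) ^ 3) := by
  simp [cubePadF]

/-- **The yardstick** `X = ⟨w, 1^{(|w|+1)^3}⟩`: the whole input (for the globals `n`, `q₁`, the
constraint list) padded to a length dominating every intermediate value of the intended computation
(so that clipped item functions are unclipped on it, and the counted loops have enough rounds). [folklore] -/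
noncomputable def dsYardF : List Bool → List Bool := fanoutFn id cubePadF

/-- `dsYardF ∈ FP`. [folklore] -/
theorem dsYardF_mem_FP : dsYardF ∈ FP := fanoutFn_mem_FP OracleCompose.id_mem_FP cubePadF_mem_FP

/-- Value of `dsYardF`. [folklore] -/
@[simp] theorem dsYardF_apply (w : List Bool) : dsYardF w = boolPair w (ones ((w.length + 1) ^ 3)) := by
  simp [dsYardF]

/-- **`litWidthF w = bin q₁`**, `q₁ = max |Σ| 1` (`[1]` if field `1` is `ε = bin 0`, else field `1`).
[cite: Hirahara2022PartialMCSP, proof of Thm. 5.2 (p. 16, literals indexed by [n] × Σ)] -/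
noncomputable def litWidthF : List Bool → List Bool := iteFn (isNilFn ∘ nthF 1) (fun _ => [true]) (nthF 1)

/-- `litWidthF ∈ FP`. [folklore] -/
theorem litWidthF_mem_FP : litWidthF ∈ FP :=
  iteFn_mem_FP (comp_mem_FP isNilFn_mem_FP (nthF_mem_FP 1)) (const_mem_FP _) (nthF_mem_FP 1)

/-- Value of `litWidthF` on every input. [folklore] -/
theorem litWidthF_eq (w : List Bool) : litWidthF w = if nthF 1 w = [] then [true] else nthF 1 w := by
  rw [litWidthF, iteFn_apply (b := decide (nthF 1 w = [])) (by simp [isNilFn])]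
  by_cases h : nthF 1 w = [] <;> simp [h]

/-- `|litWidthF w| ≤ |w| + 1`. [folklore] -/
theorem length_litWidthF_le (w : List Bool) : (litWidthF w).length ≤ w.length + 1 := by
  rw [litWidthF_eq]
  have := length_nthF_le 1 w
  split_ifs
  · simp
  · omega

/-- `encodeNat (max q 1)` from `encodeNat q`. [folklore] -/
theorem litWidthF_icode (Ψ : CSPInstance) : litWidthF (icode Ψ) = encodeNat Ψ.litWidth := by
  rw [litWidthF_eq, nthF_one_icode, CSPInstance.litWidth]
  rcases Nat.eq_zero_or_pos Ψ.alphabetSize with h | h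
  · rw [h]; rfl
  · have hne : encodeNat Ψ.alphabetSize ≠ [] := by
      intro he
      have := congrArg decodeNat he
      rw [decode_encodeNat] at this
      exact absurd this (by change Ψ.alphabetSize ≠ decodeNat []; exact h.ne')
    rw [if_neg hne, Nat.max_eq_left h]

/-- **`nq1F w = bin (n · q₁)`**, the number of CMMSA variables. [cite: Hirahara2022PartialMCSP, proof of Thm. 5.2 (p. 16)] -/
noncomputable def nq1F : List Bool → List Bool := prodFn ∘ fanoutFn (nthF 0) litWidthF

/-- `nq1F ∈ FP`. [folklore] -/
theorem nq1F_mem_FP : nq1F ∈ FP := comp_mem_FP prodFn_mem_FP (fanoutFn_mem_FP (nthF_mem_FP 0) litWidthF_mem_FP)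

/-- Value of `nq1F` on an instance code. [folklore] -/
@[simp] theorem nq1F_icode (Ψ : CSPInstance) : nq1F (icode Ψ) = encodeNat (Ψ.numVars * Ψ.litWidth) := by
  simp [nq1F, litWidthF_icode]

/-- **The literal** `L_{x,a} = bin (x q₁ + a)` on zip arguments `⟨X, ⟨p, ⟨bin x, bin a⟩⟩⟩` (`q₁` read
off the yardstick). [cite: Hirahara2022PartialMCSP, proof of Thm. 5.2 (p. 16, L_{x,r(x)})] -/
noncomputable def litF : List Bool → List Bool :=
  addFn ∘ fanoutFn (prodFn ∘ fanoutFn (nthF 2) (litWidthF ∘ fstF ∘ nthF 0)) (sndPow 2)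

/-- `litF ∈ FP`. [folklore] -/
theorem litF_mem_FP : litF ∈ FP :=
  comp_mem_FP addFn_mem_FP (fanoutFn_mem_FP
    (comp_mem_FP prodFn_mem_FP (fanoutFn_mem_FP (nthF_mem_FP 2) (comp_mem_FP litWidthF_mem_FP (comp_mem_FP fstF_mem_FP (nthF_mem_FP 0)))))
    (sndPow_mem_FP 2))

/-- Value of `litF` on a zip argument. [folklore] -/
theorem litF_apply (X p a b : List Bool) :
    litF (boolPair X (boolPair p (boolPair a b))) = encodeNat (bitsToNat a * bitsToNat (litWidthF (fstF X)) + bitsToNat b) := by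
  simp [litF]

/-- Growth of `litF`: `≤ (|a| + |b|) + (|X| + 2)`. [folklore] -/
theorem length_litF_le (X p a b : List Bool) :
    (litF (boolPair X (boolPair p (boolPair a b)))).length ≤ 1 * (a.length + b.length) + (Polynomial.X + 2).eval X.length := by
  rw [litF_apply]
  have h1 := Brick.length_encodeNat_add_le (encodeNat (bitsToNat a * bitsToNat (litWidthF (fstF X)))) b
  rw [bitsToNat_encodeNat] at h1
  have h2 := Brick.length_encodeNat_mul_le a (litWidthF (fstF X))
  have h3 := length_litWidthF_le (fstF X)
  have h4 := length_fstF_sndF_le X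
  simp only [eval_add, eval_X, eval_ofNat]
  omega

/-- The zip arguments `⟨X, ⟨bin |X|, ⟨ε, ⟨varsL, vals⟩⟩⟩⟩` from `⟨⟨X, varsL⟩, rc⟩`. [folklore] -/
noncomputable def zipArgF : List Bool → List Bool :=
  fanoutFn (fstF ∘ fstF) (fanoutFn (lenBinF ∘ fstF ∘ fstF) (fanoutFn (fun _ => []) (fanoutFn (sndF ∘ fstF) (sndF ∘ sndF))))

/-- `zipArgF ∈ FP`. [folklore] -/
theorem zipArgF_mem_FP : zipArgF ∈ FP :=
  fanoutFn_mem_FP (comp_mem_FP fstF_mem_FP fstF_mem_FP) (fanoutFn_mem_FP (comp_mem_FP lenBinF_mem_FP (comp_mem_FP fstF_mem_FP fstF_mem_FP))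
    (fanoutFn_mem_FP (const_mem_FP _) (fanoutFn_mem_FP (comp_mem_FP sndF_mem_FP fstF_mem_FP) (comp_mem_FP sndF_mem_FP sndF_mem_FP))))

/-- Value of `zipArgF`. [folklore] -/
@[simp] theorem zipArgF_apply (X varsL rc : List Bool) :
    zipArgF (boolPair (boolPair X varsL) rc) =
      boolPair X (boolPair (encodeNat X.length) (boolPair [] (boolPair varsL (sndF rc)))) := by
  simp [zipArgF]

/-- The coded list of the literals of a term: `zipWith L vars r`. [cite: Hirahara2022PartialMCSP, proof of Thm. 5.2 (p. 16, ⋀_{x ∈ dom r} L_{x,r(x)})] -/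
noncomputable def ztermF : List Bool → List Bool := zipLF litF ∘ zipArgF

/-- `ztermF ∈ FP`. [folklore] -/
theorem ztermF_mem_FP : ztermF ∈ FP :=
  comp_mem_FP (zipLF_mem_FP litF_mem_FP (w := 1) (by norm_num) length_litF_le) zipArgF_mem_FP

/-- **The term code** on `⟨⟨X, varsL⟩, rc⟩`: `⟨1ᵗ, [L_{xᵢ, rᵢ}]_{i<t}⟩`, `t = min |vars| |r|` (the
`listBool` code of `zipWith (x a ↦ x q₁ + a) vars r`). [cite: Hirahara2022PartialMCSP, proof of Thm. 5.2 (p. 16)] -/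
noncomputable def termF : List Bool → List Bool := fanoutFn (ucountFn ∘ fanoutFn (fun _ => []) ztermF) ztermF

/-- `termF ∈ FP`. [folklore] -/
theorem termF_mem_FP : termF ∈ FP :=
  fanoutFn_mem_FP (comp_mem_FP ucountFn_mem_FP (fanoutFn_mem_FP (const_mem_FP _) ztermF_mem_FP)) ztermF_mem_FP

/-- The arguments `⟨⟨X, varsL⟩, accL⟩` of the row map, from `⟨X, c⟩`. [folklore] -/
noncomputable def fArgF : List Bool → List Bool :=
  fanoutFn (fanoutFn fstF (sndF ∘ fstF ∘ sndF)) (sndF ∘ sndF ∘ sndF)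

/-- `fArgF ∈ FP`. [folklore] -/
theorem fArgF_mem_FP : fArgF ∈ FP :=
  fanoutFn_mem_FP (fanoutFn_mem_FP fstF_mem_FP (comp_mem_FP sndF_mem_FP (comp_mem_FP fstF_mem_FP sndF_mem_FP)))
    (comp_mem_FP sndF_mem_FP (comp_mem_FP sndF_mem_FP sndF_mem_FP))

/-- Value of `fArgF` on `⟨X, ccode C⟩`. [folklore] -/
@[simp] theorem fArgF_apply (X : List Bool) (C : CSPConstraint) :
    fArgF (boolPair X (ccode C)) = boolPair (boolPair X (encList (C.vars.map encodeNat))) (encList (C.accepting.map vcode)) := by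
  simp [fArgF]

/-- **The formula code** `φ_C` on `⟨X, c⟩`: the accepting-rows header of `c`, then the term codes of
the rows (item function clipped at `C₂ (|⟨X, varsL⟩| + 1)`). [cite: Hirahara2022PartialMCSP, proof of Thm. 5.2 (p. 16, φⱼ)] -/
noncomputable def formulaF (C₂ : ℕ) : List Bool → List Bool :=
  fanoutFn (fstF ∘ sndF ∘ sndF) (mapAppFn (clipF C₂ termF) ∘ fArgF)

/-- `formulaF C₂ ∈ FP`. [folklore] -/
theorem formulaF_mem_FP (C₂ : ℕ) : formulaF C₂ ∈ FP :=
  fanoutFn_mem_FP (comp_mem_FP fstF_mem_FP (comp_mem_FP sndF_mem_FP sndF_mem_FP))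
    (comp_mem_FP (mapAppFn_clipF_mem_FP C₂ termF_mem_FP) fArgF_mem_FP)

/-- **The collection `Φ`**: the constraint header `1ᵐ` of the input, then the formula codes of the
constraints (item function clipped at `C₁ (|X| + 1)`). [cite: Hirahara2022PartialMCSP, proof of Thm. 5.2 (p. 16, Φ)] -/
noncomputable def formulasF (C₁ C₂ : ℕ) : List Bool → List Bool :=
  fanoutFn (nthF 2) (mapAppFn (clipF C₁ (formulaF C₂)) ∘ fanoutFn dsYardF (sndPow 2))

/-- `formulasF C₁ C₂ ∈ FP`. [folklore] -/
theorem formulasF_mem_FP (C₁ C₂ : ℕ) : formulasF C₁ C₂ ∈ FP :=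
  fanoutFn_mem_FP (nthF_mem_FP 2) (comp_mem_FP (mapAppFn_clipF_mem_FP C₁ (formulaF_mem_FP C₂))
    (fanoutFn_mem_FP dsYardF_mem_FP (sndPow_mem_FP 2)))

/-- The membership test of the occurrence count, on `⟨⟨bin x, L⟩, ⟨c, acc⟩⟩`: "`bin x` is one of the
coded variables of `c`". [folklore] -/
noncomputable def occTest : List Bool → List Bool :=
  anyFn eqPairFn ∘ fanoutFn (fstF ∘ nthF 0) (sndF ∘ fstF ∘ nthF 1)

/-- `occTest ∈ FP`. [folklore] -/
theorem occTest_mem_FP : occTest ∈ FP :=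
  comp_mem_FP (anyFn_mem_FP eqPairFn_mem_FP oneBit_eqPairFn)
    (fanoutFn_mem_FP (comp_mem_FP fstF_mem_FP (nthF_mem_FP 0)) (comp_mem_FP sndF_mem_FP (comp_mem_FP fstF_mem_FP (nthF_mem_FP 1))))

/-- `occTest` is one-bit. [folklore] -/
theorem oneBit_occTest : OneBit occTest := (oneBit_anyFn oneBit_eqPairFn).comp _

/-- The step of the occurrence count: `acc ++ 1` if the variable occurs in the item, else `acc`. [folklore] -/
noncomputable def occCountStep : List Bool → List Bool := iteFn occTest tickStep (sndPow 1)

/-- `occCountStep ∈ FP`. [folklore] -/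
theorem occCountStep_mem_FP : occCountStep ∈ FP := iteFn_mem_FP occTest_mem_FP tickStep_mem_FP (sndPow_mem_FP 1)

/-- Value of `occCountStep` on every input. [folklore] -/
theorem occCountStep_eq (v : List Bool) : occCountStep v = if occTest v = [true] then sndPow 1 v ++ [true] else sndPow 1 v := by
  rw [occCountStep, iteFn_of_oneBit oneBit_occTest, tickStep_eq]

/-- **`occF ⟨bin x, [c₁, …, c_m]⟩ = 1^{|Ψ(x)|}`**: the number of constraints containing the variable `x`,
in unary. [cite: Hirahara2022PartialMCSP, proof of Thm. 5.2 (p. 16, w(x,a) := |Ψ(x)|)] -/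
noncomputable def occF : List Bool → List Bool := foldFn occCountStep (fun _ => [])

/-- `occF ∈ FP`. [folklore] -/
theorem occF_mem_FP : occF ∈ FP :=
  foldFn_mem_FP occCountStep_mem_FP (const_mem_FP _) (c := 1) fun v => by
    rw [occCountStep_eq]
    have e1 : sndPow 1 v = sndF (sndF v) := rfl
    rw [e1]
    split_ifs
    · rw [List.length_append, List.length_singleton]; omega
    · omega

/-- **The weight item** on `⟨X, 1ⁱ⟩`: the framed unary weight `⟨1^{|Ψ(i / q₁)|}, ε⟩` of the literal `i`.
[cite: Hirahara2022PartialMCSP, proof of Thm. 5.2 (p. 16, w(x, a) := |Ψ(x)|); Def. 5.1 (weights in unary)] -/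
noncomputable def wItemF : List Bool → List Bool :=
  fanoutFn (occF ∘ fanoutFn (divFn ∘ fanoutFn (lenBinF ∘ sndF) (litWidthF ∘ fstF ∘ fstF)) (sndPow 2 ∘ fstF ∘ fstF)) (fun _ => [])

/-- `wItemF ∈ FP`. [folklore] -/
theorem wItemF_mem_FP : wItemF ∈ FP :=
  fanoutFn_mem_FP (comp_mem_FP occF_mem_FP (fanoutFn_mem_FP
    (comp_mem_FP divFn_mem_FP (fanoutFn_mem_FP (comp_mem_FP lenBinF_mem_FP sndF_mem_FP) (comp_mem_FP litWidthF_mem_FP (comp_mem_FP fstF_mem_FP fstF_mem_FP))))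
    (comp_mem_FP (sndPow_mem_FP 2) (comp_mem_FP fstF_mem_FP fstF_mem_FP)))) (const_mem_FP _)

/-- The initial record `⟨X, ⟨bin (n q₁), ⟨1⁰, ε⟩⟩⟩` of the weight loop. [folklore] -/
noncomputable def wInitF : List Bool → List Bool := fanoutFn dsYardF (fanoutFn nq1F (fun _ => boolPair [] []))

/-- `wInitF ∈ FP`. [folklore] -/
theorem wInitF_mem_FP : wInitF ∈ FP := fanoutFn_mem_FP dsYardF_mem_FP (fanoutFn_mem_FP nq1F_mem_FP (const_mem_FP _))

/-- **The coded weight list**: the counted fold (`|X|` rounds available, `n q₁` used) concatenating the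
weight items (clipped at `C₃ (|X| + 1)`). [cite: Hirahara2022PartialMCSP, proof of Thm. 5.2 (p. 16); AroraBarak2009, §1.3 (bounded loops)] -/
noncomputable def wListF (C₃ : ℕ) : List Bool → List Bool := sndPow 2 ∘ foldLoop appF (clipF C₃ wItemF) X ∘ wInitF

/-- `wListF C₃ ∈ FP`. [folklore] -/
theorem wListF_mem_FP (C₃ : ℕ) : wListF C₃ ∈ FP :=
  comp_mem_FP (sndPow_mem_FP 2) (comp_mem_FP (foldLoop_clipF_mem_FP C₃ appF_mem_FP length_appF_le wItemF_mem_FP _) wInitF_mem_FP)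

/-- **The weight function** `w`, coded: the unary header `1^{n q₁}` (bounded binary-to-unary conversion
against the pad), then the coded list of unary weights. [cite: Hirahara2022PartialMCSP, Def. 5.1 (w represented in unary)] -/
noncomputable def weightsF (C₃ : ℕ) : List Bool → List Bool :=
  fanoutFn (binToUnaryFn ∘ fanoutFn cubePadF nq1F) (wListF C₃)

/-- `weightsF C₃ ∈ FP`. [folklore] -/
theorem weightsF_mem_FP (C₃ : ℕ) : weightsF C₃ ∈ FP :=
  fanoutFn_mem_FP (comp_mem_FP binToUnaryFn_mem_FP (fanoutFn_mem_FP cubePadF_mem_FP nq1F_mem_FP)) (wListF_mem_FP C₃)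

/-- **The code of the Dinur–Safra instance `(Φ, w, s)`** (on inputs passing the size test):
`⟨bin (n q₁), ⟨Φ, ⟨w, bin s⟩⟩⟩`. [cite: Hirahara2022PartialMCSP, proof of Thm. 5.2 (p. 16)] -/
noncomputable def mainFn (C₁ C₂ C₃ : ℕ) : List Bool → List Bool :=
  fanoutFn nq1F (fanoutFn (formulasF C₁ C₂) (fanoutFn (weightsF C₃) TbinF))

/-- `mainFn C₁ C₂ C₃ ∈ FP`. [cite: Hirahara2022PartialMCSP, Thm. 5.2 ("polynomial-time many-one reductions")] -/
theorem mainFn_mem_FP (C₁ C₂ C₃ : ℕ) : mainFn C₁ C₂ C₃ ∈ FP :=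
  fanoutFn_mem_FP nq1F_mem_FP (fanoutFn_mem_FP (formulasF_mem_FP C₁ C₂) (fanoutFn_mem_FP (weightsF_mem_FP C₃) TbinF_mem_FP))

/-! ### Lengths of codes -/

/-- A member of a coded list is shorter than the code: `2|a| + 2 ≤ |encList l|`. [folklore] -/
theorem length_le_encList_of_mem {a : List Bool} {l : List (List Bool)} (h : a ∈ l) : 2 * a.length + 2 ≤ (encList l).length := by
  rw [length_encList]
  exact List.single_le_sum (fun _ _ => Nat.zero_le _) _ (List.mem_map.2 ⟨a, h, rfl⟩)

/-- A coded list of items of length `≤ B` has length `≤ #items · (2B + 2)`. [folklore] -/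
theorem length_encList_le_of_bound {l : List (List Bool)} {B : ℕ} (h : ∀ a ∈ l, a.length ≤ B) :
    (encList l).length ≤ l.length * (2 * B + 2) := by
  induction l with
  | nil => simp
  | cons a l ih =>
    rw [encList_cons, length_boolPair, List.length_cons]
    have h1 := h a (by simp)
    have h2 := ih fun b hb => h b (by simp [hb])
    nlinarith

/-- `|vcode r| = 2|r| + 2 + |[bin v]_v|`. [folklore] -/
theorem length_vcode (r : List ℕ) : (vcode r).length = 2 * r.length + 2 + (encList (r.map encodeNat)).length := by
  simp [vcode, ones]

/-- `|acode A| = 2|A| + 2 + |[vcode r]_r|`. [folklore] -/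
theorem length_acode (A : List (List ℕ)) : (acode A).length = 2 * A.length + 2 + (encList (A.map vcode)).length := by
  simp [acode, ones]

/-- `|ccode C|`. [folklore] -/
theorem length_ccode (C : CSPConstraint) : (ccode C).length = 2 * (vcode C.vars).length + 2 + (acode C.accepting).length := by
  simp [ccode]

/-- `|icode Ψ|`. [folklore] -/
theorem length_icode (Ψ : CSPInstance) : (icode Ψ).length =
    2 * (encodeNat Ψ.numVars).length + 2 + (2 * (encodeNat Ψ.alphabetSize).length + 2 +
      (2 * Ψ.numConstraints + 2 + (encList (Ψ.constraints.map ccode)).length)) := by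
  simp [icode, ones]

/-- A constraint code is (less than half) as long as the instance code. [folklore] -/
theorem length_ccode_le {Ψ : CSPInstance} {C : CSPConstraint} (hC : C ∈ Ψ.constraints) :
    2 * (ccode C).length + 2 ≤ (icode Ψ).length := by
  have h1 := length_le_encList_of_mem (List.mem_map.2 ⟨C, hC, rfl⟩ : ccode C ∈ Ψ.constraints.map ccode)
  rw [length_icode]; omega

/-- The coded variable list is shorter than the constraint code. [folklore] -/
theorem length_varsL_le (C : CSPConstraint) : (encList (C.vars.map encodeNat)).length + 2 * C.vars.length + 2 ≤ (ccode C).length := by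
  rw [length_ccode, length_vcode]; omega

/-- A row code is shorter than the constraint code. [folklore] -/
theorem length_vcode_le_of_mem {C : CSPConstraint} {r : List ℕ} (hr : r ∈ C.accepting) :
    2 * (vcode r).length + 2 ≤ (ccode C).length := by
  have h1 := length_le_encList_of_mem (List.mem_map.2 ⟨r, hr, rfl⟩ : vcode r ∈ C.accepting.map vcode)
  rw [length_ccode, length_acode]; omega

/-- The number of accepting rows is less than half the constraint code. [folklore] -/
theorem two_mul_length_accepting_le (C : CSPConstraint) : 2 * C.accepting.length + 2 ≤ (ccode C).length := by
  rw [length_ccode, length_acode]; omega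

/-- **The total arity is at most the length of the code.** [folklore] -/
theorem totalArity_le_length_icode (Ψ : CSPInstance) : Ψ.totalArity ≤ (icode Ψ).length := by
  have h1 : Ψ.totalArity ≤ (encList (Ψ.constraints.map ccode)).length := by
    rw [CSPInstance.totalArity, length_encList, List.map_map]
    refine List.sum_le_sum fun C _ => ?_
    have := length_varsL_le C
    simp only [Function.comp_apply]; omega
  rw [length_icode]; omega

/-- The number of constraints is at most half the length of the code. [folklore] -/
theorem two_mul_numConstraints_le (Ψ : CSPInstance) : 2 * Ψ.numConstraints + 2 ≤ (icode Ψ).length := by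
  rw [length_icode]; omega

/-- The size of a literal: `|bin (x Q + v)| ≤ |bin x| + |bin Q| + |bin v| + 1`. [folklore] -/
theorem length_encodeNat_lit_le (x Q v : ℕ) :
    (encodeNat (x * Q + v)).length ≤ (encodeNat x).length + (encodeNat Q).length + (encodeNat v).length + 1 := by
  have h1 := Brick.length_encodeNat_add_le (encodeNat (x * Q)) (encodeNat v)
  have h2 := Brick.length_encodeNat_mul_le (encodeNat x) (encodeNat Q)
  simp only [bitsToNat_encodeNat] at h1 h2
  omega

/-- Members of a `zipWith` come from members of the two lists. [folklore] -/
theorem exists_of_mem_zipWith {α β γ : Type} (g : α → β → γ) : ∀ {l₁ : List α} {l₂ : List β} {c : γ},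
    c ∈ List.zipWith g l₁ l₂ → ∃ a ∈ l₁, ∃ b ∈ l₂, c = g a b
  | [], _, c, h => by simp at h
  | _ :: _, [], c, h => by simp at h
  | a :: l₁, b :: l₂, c, h => by
    rw [List.zipWith_cons_cons, List.mem_cons] at h
    rcases h with rfl | h
    · exact ⟨a, by simp, b, by simp, rfl⟩
    · obtain ⟨a', ha', b', hb', rfl⟩ := exists_of_mem_zipWith g h
      exact ⟨a', by simp [ha'], b', by simp [hb'], rfl⟩

/-- **The size of a term code**: with every `|bin x|`, `x ∈ vars`, at most `V` and `|bin Q| ≤ W`,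
`|vcode (zipWith (x v ↦ x Q + v) vars r)| ≤ 2 + |vcode r| · (2 (V + W + |vcode r|) + 6)`. [folklore] -/
theorem length_vcode_zipWith_le {vars r : List ℕ} {Q V W : ℕ} (hV : ∀ x ∈ vars, (encodeNat x).length ≤ V)
    (hW : (encodeNat Q).length ≤ W) :
    (vcode (List.zipWith (fun x v => x * Q + v) vars r)).length ≤ 2 + (vcode r).length * (2 * (V + W + (vcode r).length) + 6) := by
  set term := List.zipWith (fun x v => x * Q + v) vars r with hterm
  have ht : term.length ≤ r.length := by rw [hterm, List.length_zipWith]; exact min_le_right _ _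
  have hr : r.length ≤ (vcode r).length := by rw [length_vcode]; omega
  have hB : ∀ e ∈ term.map encodeNat, e.length ≤ V + W + (vcode r).length + 1 := by
    intro e he
    obtain ⟨c, hc, rfl⟩ := List.mem_map.1 he
    obtain ⟨x, hx, v, hv, rfl⟩ := exists_of_mem_zipWith _ hc
    have h1 := length_encodeNat_lit_le x Q v
    have h2 : (encodeNat v).length ≤ (vcode r).length := by
      have := length_le_encList_of_mem (List.mem_map.2 ⟨v, hv, rfl⟩ : encodeNat v ∈ r.map encodeNat)
      rw [length_vcode]; omega
    have h3 := hV x hx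
    omega
  have hE := length_encList_le_of_bound hB
  rw [List.length_map] at hE
  rw [length_vcode]
  nlinarith [ht, hr, hE]

/-! ### The Dinur–Safra instance: values of the bricks on instance codes -/

/-- Zipping the coded variables with the coded values computes the coded literals. [folklore] -/
theorem zipWith_encodeNat (Q : ℕ) : ∀ (vars r : List ℕ),
    List.zipWith (fun a b => encodeNat (bitsToNat a * Q + bitsToNat b)) (vars.map encodeNat) (r.map encodeNat) =
      (List.zipWith (fun x v => x * Q + v) vars r).map encodeNat
  | [], r => by simp
  | x :: vars, [] => by simp
  | x :: vars, v :: r => by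
    rw [List.map_cons, List.map_cons, List.zipWith_cons_cons, List.zipWith_cons_cons, List.map_cons,
      zipWith_encodeNat Q vars r, bitsToNat_encodeNat, bitsToNat_encodeNat]

/-- **Value of `ztermF`**: the coded literals of the term of the row `r`. [folklore] -/
theorem ztermF_apply {X : List Bool} {vars r : List ℕ} (hv : vars.length ≤ X.length) (hr : r.length ≤ X.length) :
    ztermF (boolPair (boolPair X (encList (vars.map encodeNat))) (vcode r)) =
      encList ((List.zipWith (fun x v => x * bitsToNat (litWidthF (fstF X)) + v) vars r).map encodeNat) := by
  rw [ztermF, Function.comp_apply, zipArgF_apply, sndF_vcode, zipLF_apply litF X [] le_rfl,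
    List.take_of_length_le (by simpa using hv), List.take_of_length_le (by simpa using hr)]
  simp only [zipImages, litF_apply]
  rw [zipWith_encodeNat]

/-- **Value of `termF`**: the `listBool` code of the term `⋀_{x ∈ dom r} L_{x,r(x)}`. [folklore] -/
theorem termF_apply {X : List Bool} {vars r : List ℕ} (hv : vars.length ≤ X.length) (hr : r.length ≤ X.length) :
    termF (boolPair (boolPair X (encList (vars.map encodeNat))) (vcode r)) =
      vcode (List.zipWith (fun x v => x * bitsToNat (litWidthF (fstF X)) + v) vars r) := by
  simp only [termF, fanoutFn_apply, Function.comp_apply, ztermF_apply hv hr, ucountFn_encList, List.length_map]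
  rfl

/-- Unclipping a mapped item function on a coded list. [folklore] -/
theorem mapAppFn_clipF_encList {C : ℕ} {g : List Bool → List Bool} {x : List Bool} {l : List (List Bool)}
    (h : ∀ a ∈ l, (g (boolPair x a)).length ≤ C * (x.length + 1)) :
    mapAppFn (clipF C g) (boolPair x (encList l)) = encList (l.map fun a => g (boolPair x a)) := by
  rw [mapAppFn_encList]
  exact congrArg encList (List.map_congr_left fun a ha => clipF_eq_self (by rw [fstF_boolPair]; exact h a ha))

/-- **Value of `formulaF`** on `⟨X, ccode C⟩` (rows within the clipping bound): the code of `φ_C`. [folklore] -/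
theorem formulaF_apply {C₂ : ℕ} {X : List Bool} {C : CSPConstraint} (hv : C.vars.length ≤ X.length)
    (hr : ∀ r ∈ C.accepting, r.length ≤ X.length)
    (hb : ∀ r ∈ C.accepting, (termF (boolPair (boolPair X (encList (C.vars.map encodeNat))) (vcode r))).length ≤
      C₂ * ((boolPair X (encList (C.vars.map encodeNat))).length + 1)) :
    formulaF C₂ (boolPair X (ccode C)) = acode (C.toMonotoneDNF (bitsToNat (litWidthF (fstF X)))) := by
  have h1 : formulaF C₂ (boolPair X (ccode C)) = boolPair (ones C.accepting.length)
      (mapAppFn (clipF C₂ termF) (boolPair (boolPair X (encList (C.vars.map encodeNat))) (encList (C.accepting.map vcode)))) := by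
    rw [formulaF, fanoutFn_apply, Function.comp_apply, Function.comp_apply, Function.comp_apply, sndF_boolPair,
      fstF_sndF_ccode, fArgF_apply]
  rw [h1, mapAppFn_clipF_encList (fun a ha => by obtain ⟨r, hr', rfl⟩ := List.mem_map.1 ha; exact hb r hr'),
    List.map_map]
  rw [acode, CSPConstraint.toMonotoneDNF_def, List.length_map, List.map_map]
  exact congrArg _ (congrArg encList (List.map_congr_left fun r hr' => termF_apply hv (hr r hr')))

/-- **Value of `formulasF`** on an instance code (constraints within the clipping bounds): the code of `Φ`. [folklore] -/
theorem formulasF_apply {C₁ C₂ : ℕ} {Ψ : CSPInstance}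
    (hv : ∀ C ∈ Ψ.constraints, C.vars.length ≤ (dsYardF (icode Ψ)).length)
    (hr : ∀ C ∈ Ψ.constraints, ∀ r ∈ C.accepting, r.length ≤ (dsYardF (icode Ψ)).length)
    (hb₂ : ∀ C ∈ Ψ.constraints, ∀ r ∈ C.accepting,
      (termF (boolPair (boolPair (dsYardF (icode Ψ)) (encList (C.vars.map encodeNat))) (vcode r))).length ≤
        C₂ * ((boolPair (dsYardF (icode Ψ)) (encList (C.vars.map encodeNat))).length + 1))
    (hb₁ : ∀ C ∈ Ψ.constraints, (formulaF C₂ (boolPair (dsYardF (icode Ψ)) (ccode C))).length ≤ C₁ * ((dsYardF (icode Ψ)).length + 1)) :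
    formulasF C₁ C₂ (icode Ψ) = fcode Ψ.toCMMSA.formulas := by
  have hq : bitsToNat (litWidthF (fstF (dsYardF (icode Ψ)))) = Ψ.litWidth := by
    rw [dsYardF_apply, fstF_boolPair, litWidthF_icode, bitsToNat_encodeNat]
  rw [formulasF, fanoutFn_apply, nthF_two_icode, Function.comp_apply, fanoutFn_apply, sndPow_two_icode,
    mapAppFn_clipF_encList (fun a ha => by obtain ⟨C, hC, rfl⟩ := List.mem_map.1 ha; exact hb₁ C hC),
    List.map_map]
  rw [fcode, CSPInstance.toCMMSA_formulas, List.length_map, List.map_map]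
  refine congrArg _ (congrArg encList (List.map_congr_left fun C hC => ?_))
  rw [Function.comp_apply, Function.comp_apply, formulaF_apply (hv C hC) (hr C hC) (hb₂ C hC), hq]

/-- Value of the membership test of the occurrence count. [folklore] -/
theorem occTest_apply (x : ℕ) (L acc : List Bool) (C : CSPConstraint) :
    occTest (boolPair (boolPair (encodeNat x) L) (boolPair (ccode C) acc)) = [decide (x ∈ C.vars)] := by
  simp only [occTest, Function.comp_apply, fanoutFn_apply, nthF_zero, fstF_boolPair, nthF_succ_boolPair,
    sndF_fstF_ccode]
  rw [anyFn_boolPair oneBit_eqPairFn, decNil_encList]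
  congr 1
  apply Bool.decide_congr
  simp only [List.mem_map, exists_exists_and_eq_and, eqPairFn_boolPair, List.cons.injEq, and_true, decide_eq_true_eq, encodeNat_inj]
  exact ⟨fun ⟨v, hv, h⟩ => h ▸ hv, fun h => ⟨x, h, rfl⟩⟩

/-- The left fold of conditional ticks counts. [folklore] -/
theorem foldl_cond_tick {α : Type} (p : α → Prop) [DecidablePred p] : ∀ (l : List α) (k : ℕ),
    l.foldl (fun acc a => if p a then acc ++ [true] else acc) (ones k) = ones (k + l.countP fun a => decide (p a))
  | [], k => by simp
  | a :: l, k => by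
    rw [List.foldl_cons, List.countP_cons]
    by_cases h : p a
    · rw [if_pos h, show ones k ++ [true] = ones (k + 1) by simp [ones, List.replicate_succ'], foldl_cond_tick p l,
        if_pos (decide_eq_true h)]
      congr 1; omega
    · rw [if_neg h, foldl_cond_tick p l, if_neg (by simp [h]), Nat.add_zero]

/-- **Value of `occF`**: `1^{|Ψ(x)|}`. [folklore] -/
theorem occF_apply (x : ℕ) (cs : List CSPConstraint) :
    occF (boolPair (encodeNat x) (encList (cs.map ccode))) = ones (cs.countP fun C => decide (x ∈ C.vars)) := by
  rw [occF, foldFn_boolPair, decNil_encList, List.foldl_map]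
  have hstep : (fun acc C => occCountStep (boolPair (boolPair (encodeNat x) (encList (cs.map ccode))) (boolPair (ccode C) acc))) =
      fun acc C => if x ∈ C.vars then acc ++ [true] else acc := by
    funext acc C
    rw [occCountStep_eq, occTest_apply]
    by_cases h : x ∈ C.vars <;> simp [h, sndPow]
  rw [hstep]
  simpa using foldl_cond_tick (fun C : CSPConstraint => x ∈ C.vars) cs 0

/-- **Value of the weight item**: `⟨1^{|Ψ(i / q₁)|}, ε⟩`. [folklore] -/
theorem wItemF_apply (Ψ : CSPInstance) (i : ℕ) :
    wItemF (boolPair (dsYardF (icode Ψ)) (ones i)) = boolPair (ones (Ψ.occCount (i / Ψ.litWidth))) [] := by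
  rw [wItemF, fanoutFn_apply]
  simp only [Function.comp_apply, fanoutFn_apply, fstF_boolPair, sndF_boolPair, dsYardF_apply, lenBinF_apply,
    litWidthF_icode, divFn_boolPair, bitsToNat_encodeNat, sndPow_two_icode]
  rw [show (ones i).length = i by simp [ones], occF_apply]
  rfl

/-- `encList` of a snoc. [folklore] -/
theorem encList_append_singleton : ∀ (l : List (List Bool)) (a : List Bool), encList (l ++ [a]) = encList l ++ boolPair a []
  | [], a => by simp [encList_cons]
  | b :: l, a => by
    rw [List.cons_append, encList_cons, encList_cons, encList_append_singleton l a]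
    simp [boolPair, List.append_assoc]

/-- A concatenation of framed pieces is a coded list. [folklore] -/
theorem ccat_boolPair_nil (item : ℕ → List Bool) : ∀ N : ℕ,
    ccat (fun j => boolPair (item j) []) N = encList ((List.range N).map item)
  | 0 => rfl
  | N + 1 => by
    rw [ccat_succ, ccat_boolPair_nil item N, List.range_succ, List.map_append, List.map_singleton,
      encList_append_singleton]

/-- The initial record of the weight loop on an instance code. [folklore] -/
theorem wInitF_icode (Ψ : CSPInstance) :
    wInitF (icode Ψ) = boolPair (dsYardF (icode Ψ)) (boolPair (encodeNat (Ψ.numVars * Ψ.litWidth)) (boolPair (ones 0) [])) := by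
  rw [wInitF, fanoutFn_apply, fanoutFn_apply, nq1F_icode]
  rfl

/-- **Value of the coded weight list** (enough rounds, items within the clipping bound). [folklore] -/
theorem wListF_apply {C₃ : ℕ} {Ψ : CSPInstance} (hN : Ψ.numVars * Ψ.litWidth ≤ (dsYardF (icode Ψ)).length)
    (hclip : ∀ j, j < Ψ.numVars * Ψ.litWidth →
      (wItemF (boolPair (dsYardF (icode Ψ)) (ones j))).length ≤ C₃ * ((dsYardF (icode Ψ)).length + 1)) :
    wListF C₃ (icode Ψ) =
      encList ((List.range (Ψ.numVars * Ψ.litWidth)).map fun i => ones (Ψ.occCount (i / Ψ.litWidth))) := by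
  rw [wListF, Function.comp_apply, Function.comp_apply, wInitF_icode,
    foldLoop_apply appF (clipF C₃ wItemF) (p := X) (by simpa using hN) 0 []]
  simp only [sndPow_succ_boolPair, sndPow_zero, sndF_boolPair]
  rw [foldAcc_clipF (fun j _ hj => hclip j (by omega)), foldAcc_appF, List.nil_append]
  simp only [Nat.zero_add, wItemF_apply]
  exact ccat_boolPair_nil _ _

/-- **Value of the coded weight function** on an instance code. [folklore] -/
theorem weightsF_apply {C₃ : ℕ} {Ψ : CSPInstance} (hN : Ψ.numVars * Ψ.litWidth ≤ (dsYardF (icode Ψ)).length)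
    (hpad : Ψ.numVars * Ψ.litWidth ≤ ((icode Ψ).length + 1) ^ 3)
    (hclip : ∀ j, j < Ψ.numVars * Ψ.litWidth →
      (wItemF (boolPair (dsYardF (icode Ψ)) (ones j))).length ≤ C₃ * ((dsYardF (icode Ψ)).length + 1)) :
    weightsF C₃ (icode Ψ) = boolPair (ones Ψ.toCMMSA.weight.length) (encList (Ψ.toCMMSA.weight.map ones)) := by
  rw [weightsF, fanoutFn_apply, Function.comp_apply, fanoutFn_apply, cubePadF_apply, nq1F_icode, binToUnaryFn_boolPair,
    bitsToNat_encodeNat, wListF_apply hN hclip]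
  rw [show (ones (((icode Ψ).length + 1) ^ 3)).length = ((icode Ψ).length + 1) ^ 3 by simp [ones], Nat.min_eq_left hpad]
  simp [CSPInstance.toCMMSA, Function.comp_def]

/-- **Value of `mainFn` on an instance code**, given the round and clipping bounds: the code of `Ψ.toCMMSA`. [folklore] -/
theorem mainFn_apply {C₁ C₂ C₃ : ℕ} {Ψ : CSPInstance}
    (hv : ∀ C ∈ Ψ.constraints, C.vars.length ≤ (dsYardF (icode Ψ)).length)
    (hr : ∀ C ∈ Ψ.constraints, ∀ r ∈ C.accepting, r.length ≤ (dsYardF (icode Ψ)).length)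
    (hb₂ : ∀ C ∈ Ψ.constraints, ∀ r ∈ C.accepting,
      (termF (boolPair (boolPair (dsYardF (icode Ψ)) (encList (C.vars.map encodeNat))) (vcode r))).length ≤
        C₂ * ((boolPair (dsYardF (icode Ψ)) (encList (C.vars.map encodeNat))).length + 1))
    (hb₁ : ∀ C ∈ Ψ.constraints, (formulaF C₂ (boolPair (dsYardF (icode Ψ)) (ccode C))).length ≤ C₁ * ((dsYardF (icode Ψ)).length + 1))
    (hN : Ψ.numVars * Ψ.litWidth ≤ (dsYardF (icode Ψ)).length)
    (hpad : Ψ.numVars * Ψ.litWidth ≤ ((icode Ψ).length + 1) ^ 3)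
    (hclip : ∀ j, j < Ψ.numVars * Ψ.litWidth →
      (wItemF (boolPair (dsYardF (icode Ψ)) (ones j))).length ≤ C₃ * ((dsYardF (icode Ψ)).length + 1)) :
    mainFn C₁ C₂ C₃ (icode Ψ) = ocode Ψ.toCMMSA := by
  rw [mainFn, fanoutFn_apply, fanoutFn_apply, fanoutFn_apply, nq1F_icode, formulasF_apply hv hr hb₂ hb₁,
    weightsF_apply hN hpad hclip, TbinF_icode]
  rfl

/-! ### The bounds on instance codes passing the size test -/

section Bounds

variable {Ψ : CSPInstance}

/-- The length of the yardstick. [folklore] -/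
theorem length_dsYardF (w : List Bool) : (dsYardF w).length = 2 * w.length + 2 + (w.length + 1) ^ 3 := by
  simp [ones]

/-- `(s+1)^3` dominates the products that occur. [folklore] -/
theorem cube_facts (s : ℕ) : (s + 1) * (s + 1) ≤ (s + 1) ^ 3 ∧ s * (s + 1) ≤ (s + 1) ^ 3 ∧ s + 1 ≤ (s + 1) ^ 3 ∧
    (s + 1) * ((s + 1) * (s + 1)) = (s + 1) ^ 3 := by
  have h3 : (s + 1) ^ 3 = (s + 1) * ((s + 1) * (s + 1)) := by ring
  refine ⟨?_, ?_, ?_, h3.symm⟩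
  · rw [h3]; exact Nat.le_mul_of_pos_left _ (Nat.succ_pos s)
  · rw [h3]; exact Nat.mul_le_mul (Nat.le_succ s) (Nat.le_mul_of_pos_left _ (Nat.succ_pos s))
  · rw [h3]; exact Nat.le_mul_of_pos_right _ (Nat.mul_pos (Nat.succ_pos s) (Nat.succ_pos s))

/-- On the size test, `n q₁ ≤ s (s + 1)` for `s = |icode Ψ|`. [folklore] -/
theorem numVars_mul_litWidth_le (hfit : Ψ.numVars ≤ Ψ.totalArity ∧ Ψ.alphabetSize ≤ Ψ.totalArity) :
    Ψ.numVars * Ψ.litWidth ≤ (icode Ψ).length * ((icode Ψ).length + 1) := by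
  have hT := totalArity_le_length_icode Ψ
  refine Nat.mul_le_mul (hfit.1.trans hT) ?_
  unfold CSPInstance.litWidth
  exact max_le ((hfit.2.trans hT).trans (Nat.le_succ _)) (Nat.succ_le_succ (Nat.zero_le _))

/-- `|bin q₁| ≤ s + 1`. [folklore] -/
theorem length_encodeNat_litWidth_le (Ψ : CSPInstance) : (encodeNat Ψ.litWidth).length ≤ (icode Ψ).length + 1 := by
  rw [← litWidthF_icode]; exact length_litWidthF_le _

/-- **The clipping bound of the term codes**: `|termF ⟨⟨X, varsL⟩, vcode r⟩| ≤ 8 (|⟨X, varsL⟩| + 1)`. [folklore] -/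
theorem termF_bound {C : CSPConstraint} (hC : C ∈ Ψ.constraints) {r : List ℕ} (hr : r ∈ C.accepting) :
    (termF (boolPair (boolPair (dsYardF (icode Ψ)) (encList (C.vars.map encodeNat))) (vcode r))).length ≤
      8 * ((icode Ψ).length + 1) * ((icode Ψ).length + 1) ∧
    8 * ((icode Ψ).length + 1) * ((icode Ψ).length + 1) ≤
      8 * ((boolPair (dsYardF (icode Ψ)) (encList (C.vars.map encodeNat))).length + 1) := by
  set s := (icode Ψ).length with hs
  have hcc := length_ccode_le hC
  have hvl := length_varsL_le C
  have hvr := length_vcode_le_of_mem hr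
  have hX := length_dsYardF (icode Ψ)
  obtain ⟨c1, -, c3, -⟩ := cube_facts s
  have hvX : C.vars.length ≤ (dsYardF (icode Ψ)).length := by rw [hX]; omega
  have hvr' := hvr
  rw [length_vcode] at hvr'
  have hrX : r.length ≤ (dsYardF (icode Ψ)).length := by rw [hX]; omega
  refine ⟨?_, ?_⟩
  · rw [termF_apply hvX hrX, dsYardF_apply, fstF_boolPair, litWidthF_icode, bitsToNat_encodeNat]
    have hV : ∀ x ∈ C.vars, (encodeNat x).length ≤ s := fun x hx => by
      have := length_le_encList_of_mem (List.mem_map.2 ⟨x, hx, rfl⟩ : encodeNat x ∈ C.vars.map encodeNat)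
      omega
    have h := length_vcode_zipWith_le (r := r) hV (length_encodeNat_litWidth_le Ψ)
    have ha : (vcode r).length ≤ s := by omega
    have h2 : (vcode r).length * (2 * (s + (s + 1) + (vcode r).length) + 6) ≤ s * (6 * s + 8) :=
      Nat.mul_le_mul ha (by omega)
    nlinarith [h, h2]
  · rw [length_boolPair, hX]
    nlinarith [c1, c3]

/-- **The clipping bound of the formula codes**: `|formulaF 8 ⟨X, ccode C⟩| ≤ 32 (|X| + 1)`. [folklore] -/
theorem formulaF_bound {C : CSPConstraint} (hC : C ∈ Ψ.constraints) :
    (formulaF 8 (boolPair (dsYardF (icode Ψ)) (ccode C))).length ≤ 32 * ((dsYardF (icode Ψ)).length + 1) := by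
  set s := (icode Ψ).length with hs
  have hcc := length_ccode_le hC
  have hvl := length_varsL_le C
  have hX := length_dsYardF (icode Ψ)
  have hacc := two_mul_length_accepting_le C
  obtain ⟨c1, -, c3, c4⟩ := cube_facts s
  have hvX : C.vars.length ≤ (dsYardF (icode Ψ)).length := by rw [hX]; omega
  have hrX : ∀ r ∈ C.accepting, r.length ≤ (dsYardF (icode Ψ)).length := fun r hr => by
    have := length_vcode_le_of_mem hr
    rw [length_vcode] at this; rw [hX]; omega
  rw [formulaF_apply hvX hrX (fun r hr => (termF_bound hC hr).1.trans (termF_bound hC hr).2), length_acode,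
    CSPConstraint.toMonotoneDNF_def, List.length_map, List.map_map]
  have hB : ∀ a ∈ C.accepting.map (vcode ∘ fun r => List.zipWith (fun x a => x * bitsToNat (litWidthF (fstF (dsYardF (icode Ψ)))) + a) C.vars r),
      a.length ≤ 8 * (s + 1) * (s + 1) := by
    intro a ha
    obtain ⟨r, hr, rfl⟩ := List.mem_map.1 ha
    have h1 := (termF_bound hC hr).1
    rwa [termF_apply hvX (hrX r hr)] at h1
  have hE := length_encList_le_of_bound hB
  rw [List.length_map] at hE
  have hA : C.accepting.length ≤ s := by omega
  have h3 : C.accepting.length * (2 * (8 * (s + 1) * (s + 1)) + 2) ≤ s * (2 * (8 * (s + 1) * (s + 1)) + 2) :=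
    Nat.mul_le_mul_right _ hA
  rw [hX]
  nlinarith [hE, h3, c1, c3, c4, hA]

/-- **The clipping bound of the weight items**: `|wItemF ⟨X, 1ʲ⟩| ≤ 2 (|X| + 1)`. [folklore] -/
theorem wItemF_bound (Ψ : CSPInstance) (j : ℕ) :
    (wItemF (boolPair (dsYardF (icode Ψ)) (ones j))).length ≤ 2 * ((dsYardF (icode Ψ)).length + 1) := by
  rw [wItemF_apply, length_boolPair, length_dsYardF]
  have h1 : Ψ.occCount (j / Ψ.litWidth) ≤ Ψ.numConstraints := List.countP_le_length
  have h2 := two_mul_numConstraints_le Ψ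
  simp only [ones, List.length_replicate, List.length_nil]
  omega

/-- **`mainFn 32 8 2` computes the code of `Ψ.toCMMSA` on the code of every instance passing the size
test.** [cite: Hirahara2022PartialMCSP, proof of Thm. 5.2 (p. 16)] -/
theorem mainFn_icode (hfit : Ψ.numVars ≤ Ψ.totalArity ∧ Ψ.alphabetSize ≤ Ψ.totalArity) :
    mainFn 32 8 2 (icode Ψ) = ocode Ψ.toCMMSA := by
  have hX := length_dsYardF (icode Ψ)
  obtain ⟨c1, c2, c3, -⟩ := cube_facts (icode Ψ).length
  have hnq := numVars_mul_litWidth_le hfit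
  refine mainFn_apply (fun C hC => ?_) (fun C hC r hr => ?_) (fun C hC r hr => (termF_bound hC hr).1.trans (termF_bound hC hr).2)
    (fun C hC => formulaF_bound hC) (by rw [hX]; omega) (hnq.trans c2) (fun j _ => wItemF_bound Ψ j)
  · have := length_ccode_le hC
    have := length_varsL_le C
    rw [hX]; omega
  · have := length_ccode_le hC
    have := length_vcode_le_of_mem hr
    rw [length_vcode] at this
    rw [hX]; omega

end Bounds

/-! ### The assembly -/

/-- **The string function computing `dinurSafraMap N₀ Q₀` on codes**: small well-formed instances are
solved outright, instances passing the size test are mapped to the Dinur–Safra instance, the remaining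
(off-promise) inputs to the fixed no-instance. [cite: Hirahara2022PartialMCSP, proof of Thm. 5.2 (p. 16); AroraBarak2009, §2.1 (finite patch)] -/
noncomputable def dsFn (N₀ Q₀ : ℕ) : List Bool → List Bool :=
  iteFn (smallFn N₀ Q₀) (iteFn (satFn N₀ Q₀) (fun _ => ocode trivialYesCMMSA) (fun _ => ocode trivialNoCMMSA))
    (iteFn fitsFn (mainFn 32 8 2) (fun _ => ocode trivialNoCMMSA))

/-- **`dsFn N₀ Q₀ ∈ FP`.** [cite: Hirahara2022PartialMCSP, Thm. 5.2 ("polynomial-time many-one reductions"); AroraBarak2009, §1.3] -/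
theorem dsFn_mem_FP (N₀ Q₀ : ℕ) : dsFn N₀ Q₀ ∈ FP :=
  iteFn_mem_FP (smallFn_mem_FP N₀ Q₀) (iteFn_mem_FP (satFn_mem_FP N₀ Q₀) (const_mem_FP _) (const_mem_FP _))
    (iteFn_mem_FP fitsFn_mem_FP (mainFn_mem_FP 32 8 2) (const_mem_FP _))

open Classical in
/-- **`dsFn N₀ Q₀` computes `dinurSafraMap N₀ Q₀` on instance codes.** [cite: Hirahara2022PartialMCSP, proof of Thm. 5.2 (p. 16)] -/
theorem dsFn_icode (N₀ Q₀ : ℕ) (Ψ : CSPInstance) : dsFn N₀ Q₀ (icode Ψ) = ocode (dinurSafraMap N₀ Q₀ Ψ) := by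
  unfold dsFn dinurSafraMap
  by_cases hsmall : Ψ.WellFormed ∧ Ψ.numVars ≤ N₀ ∧ Ψ.alphabetSize ≤ Q₀
  · rw [iteFn_apply (smallFn_icode N₀ Q₀ Ψ), if_pos (decide_eq_true hsmall), if_pos hsmall,
      iteFn_apply (satFn_icode hsmall.1 hsmall.2.1 hsmall.2.2)]
    by_cases hsat : Ψ.IsSatisfiable
    · rw [if_pos (decide_eq_true hsat), if_pos hsat]
    · rw [if_neg (by simp [hsat]), if_neg hsat]
  · rw [iteFn_apply (smallFn_icode N₀ Q₀ Ψ), if_neg (by simp only [decide_eq_true_eq]; exact hsmall), if_neg hsmall,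
      iteFn_apply (fitsFn_icode Ψ)]
    by_cases hfit : Ψ.numVars ≤ Ψ.totalArity ∧ Ψ.alphabetSize ≤ Ψ.totalArity
    · rw [if_pos (decide_eq_true hfit), if_pos hfit, mainFn_icode hfit]
    · rw [if_neg (by simp only [decide_eq_true_eq]; exact hfit), if_neg hfit]

end DinurSafraFP

/-- **Discharge of `dinurSafraMap_mem_FP`: the patched Dinur–Safra map is polynomial-time computable on
codes.** For all `N₀, Q₀`, the brick assembly `DinurSafraFP.dsFn N₀ Q₀ ∈ FP` satisfies
`dsFn (code Ψ) = code (dinurSafraMap N₀ Q₀ Ψ)` for every MaxCSP instance `Ψ`. Hirahara (proof of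
Thm. 5.2): the reduction `Ψ ↦ (Φ, w, s)` is a polynomial-time many-one reduction; here made explicit on
the tree's codes, with the finite patch of `CSPToCMMSAReduction.lean`.
[cite: Hirahara2022PartialMCSP, Thm. 5.2 and its proof (p. 16, "polynomial-time many-one reductions")] -/
theorem dinurSafraMap_mem_FP_holds : dinurSafraMap_mem_FP := fun N₀ Q₀ =>
  ⟨DinurSafraFP.dsFn N₀ Q₀, DinurSafraFP.dsFn_mem_FP N₀ Q₀, fun Ψ => by
    rw [DinurSafraFP.encode_eq_icode, DinurSafraFP.encode_eq_ocode, DinurSafraFP.dsFn_icode]⟩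

/-- **Hirahara 2022, Thm. 5.2 at `Δ(n) = (log n)^{1/2}` from Lemma 5.3 alone**: with the implementation
fact discharged, `Hirahara2022_thm52_sqrtLog` follows from the sliding-scale PCP in compact MaxCSP form.
[cite: Hirahara2022PartialMCSP, Thm. 5.2 and its proof (pp. 16–18)] -/
theorem Hirahara2022_thm52_sqrtLog_of_lem53' (h53 : Hirahara2022_lem53_logPow_queried) :
    MetaComplexity.Hirahara2022_thm52_sqrtLog :=
  Hirahara2022_thm52_sqrtLog_of_lem53 h53 dinurSafraMap_mem_FP_holds

end Literature.Computability.Complexity
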